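import Summits.AtomisticToContinuum.Crystallization.Theses.HullExactificationCascade
import Summits.AtomisticToContinuum.Crystallization.Theorems.HullExactificationCascadeHullGoodEverywhereDefs
import Summits.AtomisticToContinuum.Crystallization.Theorems.HullExactificationCascadeZeroDefectDensityConverse
import Summits.AtomisticToContinuum.Crystallization.Theorems.HullExactificationCascadeZeroDefectDensityScaling
import Summits.AtomisticToContinuum.Crystallization.Theorems.HullExactificationCascadeZeroDefectDensityOctahedron
import Summits.AtomisticToContinuum.Crystallization.Theorems.HullExactificationCascadeZeroDefectDensityLinkLemma
import Summits.AtomisticToContinuum.Crystallization.Theorems.HullExactificationCascadeZeroDefectDensityOctahedronSq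
import Summits.AtomisticToContinuum.Crystallization.Theorems.HullExactificationCascadeZeroDefectDensityAsmShell
import Literature.Geometry.DiscreteGeometry.KissingPatterns
import Summits.AtomisticToContinuum.Crystallization.Theorems.HullExactificationCascadeZeroDefectDensityCapAtoms
import Summits.AtomisticToContinuum.Crystallization.Theorems.HullExactificationCascadeZeroDefectDensityLinkQ
import Summits.AtomisticToContinuum.Crystallization.Theorems.HullExactificationCascadeZeroDefectDensityPins
import Summits.AtomisticToContinuum.Crystallization.Theorems.HullExactificationCascadeZeroDefectDensityCoordsFcc
import Summits.AtomisticToContinuum.Crystallization.Theorems.HullExactificationCascadeZeroDefectDensityCoordsHcp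
import Summits.AtomisticToContinuum.Crystallization.Theorems.HullExactificationCascadeZeroDefectDensitySoftDegreeLeFour
import Summits.AtomisticToContinuum.Crystallization.Theorems.HullExactificationCascadeZeroDefectDensityCensusCore
import Summits.AtomisticToContinuum.Crystallization.Theorems.HullExactificationCascadeZeroDefectDensityCensusContain
import Summits.AtomisticToContinuum.Crystallization.Theorems.HullExactificationCascadeZeroDefectDensityCombClassification
import Summits.AtomisticToContinuum.Crystallization.Theorems.HullExactificationCascadeZeroDefectDensityCensusFrame
import Summits.AtomisticToContinuum.Crystallization.Theorems.HullExactificationCascadeZeroDefectDensityCensusCert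
import Summits.AtomisticToContinuum.Crystallization.Theorems.HullExactificationCascadeZeroDefectDensityLocalStructure
import Literature.Geometry.DiscreteGeometry.SphericalCapVolume
import Literature.Geometry.DiscreteGeometry.SolidAngleFraction
import HarnessLib

/-!
# Birth skeleton (BC3) for crux `ZeroDefectDensity` — item stmt-AtomisticToContinuum-12086,
# route `HullExactificationCascade` (rank 2, XL) — reshaped by lead c4, RESHAPED AGAIN by lead c5 (2026-08-17)

Crux (verbatim the route decl, concluded BY NAME below): for every sequence `x N` of Lennard-Jones
ground states in `ℝ³`, the fraction of particles whose first shell is NOT `1/20`-good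
(`SiteGood (Set.range (x N)) (x N i)`, definitionally the inlined clause) tends to `0`.

## The line `birth`, c5 form: SOFT KISSING ORDER (gap 7/5), then an EFFECTIVE LOCAL HALES KERNEL AT THE
## LINE'S OWN CONSTANTS (tolerance 1/4000, gap 7/5) split VORONOI-CENSUS-STYLE, then c4's two-shell rigidity

Lead c4 proved the crux in tree modulo `stub_softKissingOrder` (energetic; gap `1.31`) and
`stub_localHalesKernel` = VERBATIM `BrittleRungDescent.LocalHalesKernel` (stmt-9208: tolerance `1/400`,
gap `63/50`).  But the composition only ever applies the kernel to `1/4000`-soft shells with the line's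
own gap, and 9208's constants are where Hales's census is thin (E ≥ 23 margin `1.648 vs 1.62`; tame
graph 2 alive numerically to `η ≈ 0.0175`).  This reshape (i) raises the line's one free
HYPOTHESIS-side parameter, the gap, from `131/100` to `7/5` (fcc/hcp second distance is `√2·a`; every
landed c4 lemma applies by monotonicity `7/5 ≥ 131/100`, `kissed_131_of_75`), and (ii) replaces the
verbatim-9208 stub by the kernel the composition consumes — one-shell, tolerance `1/4000`, gap `7/5` —
split into four registered stubs over the finite datum `(u, p : Fin 12 → ℝ³)` (radii in
`[1 - 1/4000, 1 + 1/4000]`, pairwise distances in `[1 - 1/4000, 1 + 1/4000] ∪ [7/5, ∞)`), following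
Hales (arXiv:1209.6043) but with a census that the raised gap makes ELEMENTARY (lead c5 numerics,
folder `numerics/`: `constants.py`, `census_scan.py`, `enum_maps.py`, `orient_check.py`):

* `stub_softDegreeLeFour` (M) — soft Lemma 7: at most four soft contacts per shell point (azimuths
  about `u pᵢ`: any two neighbours `≥ 70.46°` apart, contact pairs `≤ 70.60°`, gap pairs `≥ 107.77°`;
  five cyclic gaps cannot sum to `360°`).  Exact template PROVED in tree: `IsKissingConfig.degree_le_four`.
* `stub_voronoiCensus` (L; the lead's) — every shell point has EXACTLY four soft contacts, exactly two
  pairs of which are themselves in contact.  Mechanism (NOT Hales's Delaunay/`L12` census): the twelve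
  regions `Cᵢ = cap(pᵢ, 44.41°) ∩ ⋂_{contacts j} {closer to pᵢ than to pⱼ}` on the unit sphere of
  directions about `u` are pairwise disjoint (gap angle `88.83° = 2 · 44.41°`), so their areas sum to
  `≤ 4π = 12 · (π/3)`; a (2,2)-vertex region has area `≥ π/3 − 0.0015`, a `(s,s,s,X)` 4-vertex
  `≥ π/3 + 0.0367`, a `≤ 3`-contact vertex `≥ π/3 + 0.128` (worst case over the soft windows), and
  `11·(−0.0015) + 0.0367 > 0`.  (At gap `63/50`, `1/400` this crude census fails by `0.39`; it is the
  raised gap that buys it.)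
* `stub_localStructure` (M/L) — metric ⇒ combinatorial: the azimuthal successor `σ v` on the four
  contacts of `v` is a 4-cycle; a SMALL corner `(a, σ v a)` (the two in contact) closes into a triangle
  coherently (`σ a (σ v a) = v`, `σ (σ v a) v = a` — one determinant, cyclically permuted); a LARGE
  corner (pair at `90° ± 1.2°`) closes into a quadrilateral: `w := σ a⁻¹ v` is within `62°` of `σ v a`,
  hence a soft contact of it by the dichotomy, and the quad's four rotations agree (`orient_check.py`
  verifies all identities on the exact fcc/hcp shells).
* `stub_combClassification` (L; pure combinatorics on `Fin 12`, decidable) — a rotation system on a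
  4-regular graph on twelve vertices whose traced faces are triangles and quadrilaterals, two of each at
  every vertex, is the cuboctahedron or the anticuboctahedron graph (`enum_maps.py`: exhaustive search,
  11 898 nodes, exactly 2 maps; with pentagons and the node types `(2,2,0),(3,0,1),(2,1,1),(2,0,2)`
  allowed, 2.07·10⁷ nodes, still exactly 2), returned as `Fin 12 ≃ fccKissingPattern / hcpKissingPattern`
  matching contacts with unit pattern distances (tree: `nonempty_tameContactGraph_one_iso_fcc`,
  `nonempty_tameContactGraph_zero_iso_hcp`).  Route: a verified growth search (`KissingSearch*` family as
  template, far smaller) or the medial-graph / bicupola hand argument.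

`kernel_of_stubs` (PROVED here) composes the four into the one-shell kernel at `(1/4000, 7/5)` with the
`1/400`-phrased conclusion `IsoFccHcp` that c4's landed `stub_capAtoms`/`stub_pins`/`stub_assembly` consume;
`ZeroDefectDensity_of : ZeroDefectDensity` is the kernel-checked composition (this file's ONLY `sorry`s are
the five `stub_*`): `tendsto_density_mono` reduces the crux to `stub_softKissingOrder` through
`siteGood_of_softKissedNbhd` (= scaling ∘ c4 assembly ∘ c4 capAtoms ∘ kernel¹³ ∘ two-shell bookkeeping).
9208 still implies stubs K1–K4 jointly (monotonicity), so `blocked-on stmt-9208` remains a fallback.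
Disproof.lean: none exists for this crux (`ledger crux ls`, 2026-08-17).  Negatives honoured: every
count-only / one-shell soft witness on record (DecahedralSoftShell, torn icosahedron, D₅ₕ prism at
`η ≥ 0.0067`, bct(27/25) at slack 21/20) has a 5-valent vertex or violates the `7/5` gap two shells deep.

Registered signatures are ONE-LINE, fully qualified and `:=`-free; the readable `def`s below are
documentation only and are NOT used in the registered signatures.
-/

noncomputable section

namespace Summit.AtomisticToContinuum.Crystallization.Cruxes.ZeroDefectDensity.Birth

open Filter Topology

/-! ## Registered stubs (the ONLY `sorry`s of the file; one-line, fully qualified signatures) -/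

/-- **STUB 1 — soft kissing order a.e., gap `7/5`** (ENERGETIC; open-problem-sized; c4/c5 verdict:
promote).  In Lennard-Jones ground states the fraction of particles `i` for which NO scale `a > 0` makes
every particle within `13/5·a` of `x i` `1/4000`-softly twelve-kissed at scale `a` with gap `7/5·a`
tends to `0`.  Why it might fail: a positive density of non-twelve-coordinated / `≥ 2.5·10⁻⁴`-strained
sites in bulk LJ ground states, or no provable energy ⇒ coordination inequality in `d = 3` (barriers
IcosahedralClusters, TetrahedralFrustration, LocalizedPotentialsExcludeLennardJones).  The gap `7/5`
(raised from `131/100` by c5) is still below the fcc/hcp second-neighbour distance `√2·(1 - 1/4000)·a`. -/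
theorem stub_softKissingOrder : ∀ (x : (N : ℕ) → (Fin N → EuclideanSpace ℝ (Fin 3))), (∀ N, Literature.MathematicalPhysics.StatisticalMechanics.IsGroundState Literature.MathematicalPhysics.StatisticalMechanics.lennardJones (x N)) → Filter.Tendsto (fun N : ℕ => (Nat.card {i : Fin N // ¬ (∃ a : ℝ, 0 < a ∧ ∀ v ∈ Set.range (x N), dist (x N i) v ≤ 13 / 5 * a → ((∀ w ∈ Set.range (x N), w ≠ v → (1 - 1 / 4000) * a ≤ dist v w ∧ (dist v w ≤ (1 + 1 / 4000) * a ∨ 7 / 5 * a ≤ dist v w)) ∧ {w ∈ Set.range (x N) | w ≠ v ∧ dist v w ≤ (1 + 1 / 4000) * a}.ncard = 12))} : ℝ) / (N : ℝ)) Filter.atTop (nhds (0 : ℝ)) := by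
  sorry

/-- **STUB K1 — soft Lemma 7: at most four soft contacts per shell point** — CLOSED: proved in
`Theorems/HullExactificationCascadeZeroDefectDensitySoftDegreeLeFour.lean` (p163008, lead c5 wave 1, worker K1) and
imported here by name.  For twelve
points `p i` with `dist u (p i) ∈ [1 - 1/4000, 1 + 1/4000]` and pairwise distances in
`[1 - 1/4000, 1 + 1/4000] ∪ [7/5, ∞)`, every `p i` has at most four `p j` within `1 + 1/4000`.
Azimuths about the axis `u (p i)`: any two neighbours `≥ 70.46°` apart, contact pairs `≤ 70.60°`,
gap pairs `≥ 107.77°` (`numerics/constants.py`); five cyclic gaps would all have to be contact pairs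
(`4·70.46 + 107.77 > 360`) and then sum to `≤ 5·70.60 < 360`.  Exact template PROVED in tree:
`Literature.Geometry.DiscreteGeometry.IsKissingConfig.degree_le_four` (`KissingNodeDegree.lean`);
c4's azimuth toolkit: `…ZeroDefectDensityLinkLemmaAux.lean`. -/
theorem stub_softDegreeLeFour : ∀ (u : EuclideanSpace ℝ (Fin 3)) (p : Fin 12 → EuclideanSpace ℝ (Fin 3)), (∀ i : Fin 12, 1 - 1 / 4000 ≤ dist u (p i) ∧ dist u (p i) ≤ 1 + 1 / 4000) → (∀ i j : Fin 12, i ≠ j → 1 - 1 / 4000 ≤ dist (p i) (p j) ∧ (dist (p i) (p j) ≤ 1 + 1 / 4000 ∨ 7 / 5 ≤ dist (p i) (p j))) → ∀ i : Fin 12, {j : Fin 12 | j ≠ i ∧ dist (p i) (p j) ≤ 1 + 1 / 4000}.ncard ≤ 4 := by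
  exact Summit.AtomisticToContinuum.Crystallization.Theorems.ZeroDefectDensityBirth.stub_softDegreeLeFour

/-- **STUB K2a — the two certified model areas** — CLOSED: proved in `Theorems/HullExactificationCascadeZeroDefectDensityCensusCert.lean`
(p168084; + …CensusCertFan p166678, …CensusCertTri p167591, …CensusCertSeg p167895, …CensusCertOv p167923; lead c5 wave 1b, worker K2a:
circumscribed fan of 55 integer cones for SEG, inscribed fan of 23 for OV, certificates by `decide +kernel`) and imported by name.
Was (M/L; pure computation on two FIXED regions of the unit ball; no configuration):  `SEG := capCone e_z (893/1250) ∩ {x | x_z < ⟪c_s, x⟫}` with the rational unit proxy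
`c_s = (526205, 0, 304212)/607813` (`cos = 0.5005026 ≥` every contact cosine) has ball fraction
`≤ 16423/10⁶` (true value `0.2062760/(4π) = 0.0164149`, slack `1.0·10⁻⁴` in area), and
`OV := capCone e_z (893/1250) ∩ {x_z < ⟪c₁, x⟫} ∩ {x_z < ⟪c₂, x⟫}` with `c₁ = (215683, 0, 124356)/248965`
(`cos = 0.4994919 ≤` every contact cosine) and `c₂ = c₁` rotated about `e_z` by the proxy azimuth
`(cos, sin) = (4680, 13289)/14089` (`70.599° ≥` every contact-pair azimuth) has ball fraction `≥ 753/250000`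
(true `0.0378865/(4π) = 0.0030149`, slack `3.7·10⁻⁵`).  Route: both regions are convex cones; inscribe fans of
trihedral cones with integer Pythagorean generators (norms integral ⇒ side cosines rational), add their excesses
through Euler's formula `1 − cos E = eulerF` (`Literature.Geometry.DiscreteGeometry.one_sub_cos_sphExcess`,
`sphExcess_eq_four_pi_mul_solidAngleFraction`) and `E ≥ √(2(1 − cos E))`; for SEG bound the COMPLEMENT
`capCone ∩ {x_z ≥ ⟪c_s,x⟫}` from below and use `volume_capCone_div` (`(1 − c)/2`); ≈ 190 arc vertices for SEG's
complement, ≈ 20 for OV (lead numerics `numerics/closed_forms.py`, `proxies`). Why it might fail: only arithmetic. -/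
theorem stub_censusCert : Literature.Geometry.DiscreteGeometry.ballFraction (0 : EuclideanSpace ℝ (Fin 3)) (Literature.Geometry.DiscreteGeometry.capCone (EuclideanSpace.single (2 : Fin 3) (1 : ℝ)) (893 / 1250) ∩ {x : EuclideanSpace ℝ (Fin 3) | inner ℝ (EuclideanSpace.single (2 : Fin 3) (1 : ℝ)) x < inner ℝ (WithLp.toLp 2 ![(526205 / 607813 : ℝ), 0, 304212 / 607813] : EuclideanSpace ℝ (Fin 3)) x}) ≤ 16423 / 1000000 ∧ (753 / 250000 : ℝ) ≤ Literature.Geometry.DiscreteGeometry.ballFraction (0 : EuclideanSpace ℝ (Fin 3)) (Literature.Geometry.DiscreteGeometry.capCone (EuclideanSpace.single (2 : Fin 3) (1 : ℝ)) (893 / 1250) ∩ {x : EuclideanSpace ℝ (Fin 3) | inner ℝ (EuclideanSpace.single (2 : Fin 3) (1 : ℝ)) x < inner ℝ (WithLp.toLp 2 ![(215683 / 248965 : ℝ), 0, 124356 / 248965] : EuclideanSpace ℝ (Fin 3)) x} ∩ {x : EuclideanSpace ℝ (Fin 3) | inner ℝ (EuclideanSpace.single (2 : Fin 3) (1 : ℝ))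 x < inner ℝ (WithLp.toLp 2 ![(215683 / 248965 * (4680 / 14089) : ℝ), 215683 / 248965 * (13289 / 14089), 124356 / 248965] : EuclideanSpace ℝ (Fin 3)) x}) := by
  exact Summit.AtomisticToContinuum.Crystallization.Theorems.ZeroDefectDensityBirth.stub_censusCert

/-- **STUB K2b — tangent-plane windows at a vertex** — CLOSED: proved in `Theorems/HullExactificationCascadeZeroDefectDensityCensusFrame.lean`
(p165369; aux …CensusFrameAux.lean p165088; lead c5 wave 1b, worker K2b; helpers `cf_*`) and imported here by name.  Was (M; extends worker K1's helpers
`sdeg_vany`, `sdeg_vcontactLower`, `sdeg_inner_eq_cos_sub` of `…SoftDegreeLeFour.lean`).  With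
`dir i = ‖p i − u‖⁻¹ • (p i − u)`: (1) PIGEONHOLE — a vertex with four soft contacts has at least two contact
pairs among them (azimuths about `dir i`: any two contacts `≥ 70.46°` apart, a contact pair `≤ 70.60°`, a
non-contact pair `≥ 107.76°`; three large gaps `+` one more exceed `360°`); (2) TRIPLES — among any three
contacts `j, k, l` of `i` some two have DISJOINT "beyond" regions inside the cap of `i`
(`capCone (dir i) (893/1250) ∩ {⟪dir i,x⟫ < ⟪dir j,x⟫} ∩ {⟪dir i,x⟫ < ⟪dir k,x⟫} = ∅`): three coplanar tangent
directions with all pairwise planar cosines in `(−0.31, 0.345]` would have positive Gram determinant, and a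
pair with planar cosine `≤ −0.31` (azimuth `≥ 108.06° > 2·53.92°`) has disjoint regions (inside the cap
`tan(polar) < 0.9795` while beyond both bisectors forces `tan(polar) > 0.981`); (3) FAR PAIRS — two
non-contacts (`dist ≥ 7/5`, direction cosine `≤ 0.02049 < 2·(893/1250)² − 1 = 0.02073`) have disjoint cap
cones of parameter `893/1250`. -/
theorem stub_censusFrame : ∀ (u : EuclideanSpace ℝ (Fin 3)) (p : Fin 12 → EuclideanSpace ℝ (Fin 3)), (∀ i : Fin 12, 1 - 1 / 4000 ≤ dist u (p i) ∧ dist u (p i) ≤ 1 + 1 / 4000) → (∀ i j : Fin 12, i ≠ j → 1 - 1 / 4000 ≤ dist (p i) (p j) ∧ (dist (p i) (p j) ≤ 1 + 1 / 4000 ∨ 7 / 5 ≤ dist (p i) (p j))) → (∀ i : Fin 12, {j : Fin 12 | j ≠ i ∧ dist (p i) (p j) ≤ 1 + 1 / 4000}.ncard ≤ 4) → (∀ i : Fin 12, {j : Fin 12 | j ≠ i ∧ dist (p i) (p j) ≤ 1 + 1 / 4000}.ncard = 4 → 2 ≤ {q : Fin 12 × Fin 12 | q.1 < q.2 ∧ q.1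 ≠ i ∧ q.2 ≠ i ∧ dist (p i) (p q.1) ≤ 1 + 1 / 4000 ∧ dist (p i) (p q.2) ≤ 1 + 1 / 4000 ∧ dist (p q.1) (p q.2) ≤ 1 + 1 / 4000}.ncard) ∧ (∀ i j k l : Fin 12, j ≠ i → k ≠ i → l ≠ i → j ≠ k → j ≠ l → k ≠ l → dist (p i) (p j) ≤ 1 + 1 / 4000 → dist (p i) (p k) ≤ 1 + 1 / 4000 → dist (p i) (p l) ≤ 1 + 1 / 4000 → (Literature.Geometry.DiscreteGeometry.capCone (‖p i - u‖⁻¹ • (p i - u)) (893 / 1250) ∩ {x : EuclideanSpace ℝ (Fin 3) | inner ℝ (‖p i - u‖⁻¹ • (p i - u)) x < inner ℝ (‖p j - u‖⁻¹ • (p j - u)) x} ∩ {x : EuclideanSpace ℝ (Fin 3) | inner ℝ (‖p i - u‖⁻¹ • (p i - u)) x < inner ℝ (‖p k - u‖⁻¹ • (p k - u)) x} = ∅ ∨ Literature.Geometry.DiscreteGeometry.capCone (‖p i - u‖⁻¹ • (p i - u)) (893 / 1250) ∩ {x : EuclideanSpace ℝ (Fin 3) | inner ℝ (‖p i - u‖⁻¹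 • (p i - u)) x < inner ℝ (‖p j - u‖⁻¹ • (p j - u)) x} ∩ {x : EuclideanSpace ℝ (Fin 3) | inner ℝ (‖p i - u‖⁻¹ • (p i - u)) x < inner ℝ (‖p l - u‖⁻¹ • (p l - u)) x} = ∅ ∨ Literature.Geometry.DiscreteGeometry.capCone (‖p i - u‖⁻¹ • (p i - u)) (893 / 1250) ∩ {x : EuclideanSpace ℝ (Fin 3) | inner ℝ (‖p i - u‖⁻¹ • (p i - u)) x < inner ℝ (‖p k - u‖⁻¹ • (p k - u)) x} ∩ {x : EuclideanSpace ℝ (Fin 3) | inner ℝ (‖p i - u‖⁻¹ • (p i - u)) x < inner ℝ (‖p l - u‖⁻¹ • (p l - u)) x} = ∅)) ∧ (∀ i j : Fin 12, i ≠ j → ¬ dist (p i) (p j) ≤ 1 + 1 / 4000 → Literature.Geometry.DiscreteGeometry.capCone (‖p i - u‖⁻¹ • (p i - u)) (893 / 1250) ∩ Literature.Geometry.DiscreteGeometry.capCone (‖p j - u‖⁻¹ • (p j - u)) (893 / 1250) = ∅) := by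
  exact Summit.AtomisticToContinuum.Crystallization.Theorems.ZeroDefectDensityBirth.stub_censusFrame

/-- **STUB K2c — containment and transport** — CLOSED: proved in `Theorems/HullExactificationCascadeZeroDefectDensityCensusContain.lean`
(p164944, lead c5 wave 1b, worker K2c; helpers `ccon_*`) and imported here by name.  Was (M):  For a contact pair
`(i, j)` the region `capCone (dir i) (893/1250) ∩ {⟪dir i,x⟫ < ⟪dir j,x⟫}` is carried by a linear isometry
(orthonormal frame `dir i ↦ e_z`, `unit((dir j)^⊥-part) ↦ e_x`) INTO the model region SEG of K2a — bisector
regions of contacts in a common plane through `dir i` are NESTED inside the cap by polar angle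
(`⟪d,x⟫ > ⟪a,x⟫ ⇔ ⟪e,x⟫ > tan(θ/2)·⟪a,x⟫`, `tan(θ/2) = √((1−cos θ)/(1+cos θ))` monotone), and the proxy `c_s` has the
smaller polar angle (`cos 0.5005026 ≥ 0.5004998`); hence ball fraction `≤ 16423/10⁶`.  For a contact pair
`j ~ k` of contacts of `i`, the intersection of the two regions CONTAINS the frame image of OV: reverse
nesting in polar angle (`0.4994919 ≤ 0.4994997`) and the azimuth lemma (a tangent direction between `e_x` and
the proxy at `70.599°` is a nonnegative combination `α e₀ + β e_g` with `α + β ≥ 1`, from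
`(1 − c)/s ≤ (1 − C)/S` for `c ≥ C`); hence ball fraction `≥ 753/250000`.  Volume invariance:
`LinearIsometryEquiv.measurePreserving`. -/
theorem stub_censusContain : (Literature.Geometry.DiscreteGeometry.ballFraction (0 : EuclideanSpace ℝ (Fin 3)) (Literature.Geometry.DiscreteGeometry.capCone (EuclideanSpace.single (2 : Fin 3) (1 : ℝ)) (893 / 1250) ∩ {x : EuclideanSpace ℝ (Fin 3) | inner ℝ (EuclideanSpace.single (2 : Fin 3) (1 : ℝ)) x < inner ℝ (WithLp.toLp 2 ![(526205 / 607813 : ℝ), 0, 304212 / 607813] : EuclideanSpace ℝ (Fin 3)) x}) ≤ 16423 / 1000000 ∧ (753 / 250000 : ℝ) ≤ Literature.Geometry.DiscreteGeometry.ballFraction (0 : EuclideanSpace ℝ (Fin 3)) (Literature.Geometry.DiscreteGeometry.capCone (EuclideanSpace.single (2 : Fin 3) (1 : ℝ)) (893 / 1250) ∩ {x : EuclideanSpace ℝ (Fin 3) | inner ℝ (EuclideanSpace.single (2 : Fin 3) (1 : ℝ)) x < inner ℝ (WithLp.toLp 2 ![(215683 / 248965 : ℝ), 0, 124356 / 248965]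 : EuclideanSpace ℝ (Fin 3)) x} ∩ {x : EuclideanSpace ℝ (Fin 3) | inner ℝ (EuclideanSpace.single (2 : Fin 3) (1 : ℝ)) x < inner ℝ (WithLp.toLp 2 ![(215683 / 248965 * (4680 / 14089) : ℝ), 215683 / 248965 * (13289 / 14089), 124356 / 248965] : EuclideanSpace ℝ (Fin 3)) x})) → ∀ (u : EuclideanSpace ℝ (Fin 3)) (p : Fin 12 → EuclideanSpace ℝ (Fin 3)), (∀ i : Fin 12, 1 - 1 / 4000 ≤ dist u (p i) ∧ dist u (p i) ≤ 1 + 1 / 4000) → (∀ i j : Fin 12, i ≠ j → 1 - 1 / 4000 ≤ dist (p i) (p j) ∧ (dist (p i) (p j) ≤ 1 + 1 / 4000 ∨ 7 / 5 ≤ dist (p i) (p j))) → (∀ i j : Fin 12, i ≠ j → dist (p i) (p j) ≤ 1 + 1 / 4000 → Literature.Geometry.DiscreteGeometry.ballFraction (0 : EuclideanSpace ℝ (Fin 3)) (Literature.Geometry.DiscreteGeometry.capCone (‖p i - u‖⁻¹ • (p i - u)) (893 / 1250) ∩ {x : EuclideanSpace ℝ (Fin 3) | inner ℝ (‖p i -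 u‖⁻¹ • (p i - u)) x < inner ℝ (‖p j - u‖⁻¹ • (p j - u)) x}) ≤ 16423 / 1000000) ∧ (∀ i j k : Fin 12, i ≠ j → i ≠ k → j ≠ k → dist (p i) (p j) ≤ 1 + 1 / 4000 → dist (p i) (p k) ≤ 1 + 1 / 4000 → dist (p j) (p k) ≤ 1 + 1 / 4000 → (753 / 250000 : ℝ) ≤ Literature.Geometry.DiscreteGeometry.ballFraction (0 : EuclideanSpace ℝ (Fin 3)) (Literature.Geometry.DiscreteGeometry.capCone (‖p i - u‖⁻¹ • (p i - u)) (893 / 1250) ∩ {x : EuclideanSpace ℝ (Fin 3) | inner ℝ (‖p i - u‖⁻¹ • (p i - u)) x < inner ℝ (‖p j - u‖⁻¹ • (p j - u)) x} ∩ {x : EuclideanSpace ℝ (Fin 3) | inner ℝ (‖p i - u‖⁻¹ • (p i - u)) x < inner ℝ (‖p k - u‖⁻¹ • (p k - u)) x})) := by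
  exact Summit.AtomisticToContinuum.Crystallization.Theorems.ZeroDefectDensityBirth.stub_censusContain

/-- **STUB K2d — the census core** — CLOSED: proved in `Theorems/HullExactificationCascadeZeroDefectDensityCensusCore.lean`
(p164536; tools …CensusCoreAux.lean p164319; lead c5) and imported here by name.  Was (L; the lead's): from K2b's windows and K2c's two bounds, the VORONOI
OWNERSHIP CENSUS.  The regions `C i := capCone (dir i) (893/1250) ∩ ⋂_{contacts j} {⟪dir j,x⟫ ≤ ⟪dir i,x⟫}`
are pairwise a.e.-disjoint (contact pairs: opposite closed half-spaces meet in a null plane; non-contacts: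
K2b(3)), so `Σᵢ ballFraction 0 (C i) ≤ 1` (`Literature.Geometry.DiscreteGeometry.sum_ballFraction_le_one`);
`capCone = C i ⊔ ⋃_j A ij` and, all triple intersections being empty (K2b(2)), inclusion–exclusion gives
`ballFraction (C i) ≥ (1 − 893/1250)/2 − kᵢ·16423/10⁶ + mᵢ·753/250000` (`volume_capCone_div`, K2c), `kᵢ ≤ 4`
the number of contacts, `mᵢ` the number of contact pairs among them; `(k, m) = (4, ≤1)` is excluded by K2b(1),
`(4,2)` gives `1/12 − 2.05·10⁻⁴`, every other class `≥ 1/12 + 2.8·10⁻³` (`(4,3)`; `k ≤ 3` more), and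
`12·0.1428 − 48·0.016423 + 25·0.003012 = 1.0006 > 1`: every vertex is `(4, 2)`. -/
theorem stub_censusCore : (∀ (u : EuclideanSpace ℝ (Fin 3)) (p : Fin 12 → EuclideanSpace ℝ (Fin 3)), (∀ i : Fin 12, 1 - 1 / 4000 ≤ dist u (p i) ∧ dist u (p i) ≤ 1 + 1 / 4000) → (∀ i j : Fin 12, i ≠ j → 1 - 1 / 4000 ≤ dist (p i) (p j) ∧ (dist (p i) (p j) ≤ 1 + 1 / 4000 ∨ 7 / 5 ≤ dist (p i) (p j))) → (∀ i : Fin 12, {j : Fin 12 | j ≠ i ∧ dist (p i) (p j) ≤ 1 + 1 / 4000}.ncard ≤ 4) → (∀ i : Fin 12, {j : Fin 12 | j ≠ i ∧ dist (p i) (p j) ≤ 1 + 1 / 4000}.ncard = 4 → 2 ≤ {q : Fin 12 × Fin 12 | q.1 < q.2 ∧ q.1 ≠ i ∧ q.2 ≠ i ∧ dist (p i) (p q.1) ≤ 1 + 1 / 4000 ∧ dist (p i) (p q.2) ≤ 1 + 1 / 4000 ∧ dist (p q.1) (p q.2) ≤ 1 + 1 / 4000}.ncard) ∧ (∀ i j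 k l : Fin 12, j ≠ i → k ≠ i → l ≠ i → j ≠ k → j ≠ l → k ≠ l → dist (p i) (p j) ≤ 1 + 1 / 4000 → dist (p i) (p k) ≤ 1 + 1 / 4000 → dist (p i) (p l) ≤ 1 + 1 / 4000 → (Literature.Geometry.DiscreteGeometry.capCone (‖p i - u‖⁻¹ • (p i - u)) (893 / 1250) ∩ {x : EuclideanSpace ℝ (Fin 3) | inner ℝ (‖p i - u‖⁻¹ • (p i - u)) x < inner ℝ (‖p j - u‖⁻¹ • (p j - u)) x} ∩ {x : EuclideanSpace ℝ (Fin 3) | inner ℝ (‖p i - u‖⁻¹ • (p i - u)) x < inner ℝ (‖p k - u‖⁻¹ • (p k - u)) x} = ∅ ∨ Literature.Geometry.DiscreteGeometry.capCone (‖p i - u‖⁻¹ • (p i - u)) (893 / 1250) ∩ {x : EuclideanSpace ℝ (Fin 3) | inner ℝ (‖p i - u‖⁻¹ • (p i - u)) x < inner ℝ (‖p j - u‖⁻¹ • (p j - u)) x} ∩ {x : EuclideanSpace ℝ (Fin 3) | inner ℝ (‖p i - u‖⁻¹ • (p i - u)) x < inner ℝ (‖p l - u‖⁻¹ • (p l -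 u)) x} = ∅ ∨ Literature.Geometry.DiscreteGeometry.capCone (‖p i - u‖⁻¹ • (p i - u)) (893 / 1250) ∩ {x : EuclideanSpace ℝ (Fin 3) | inner ℝ (‖p i - u‖⁻¹ • (p i - u)) x < inner ℝ (‖p k - u‖⁻¹ • (p k - u)) x} ∩ {x : EuclideanSpace ℝ (Fin 3) | inner ℝ (‖p i - u‖⁻¹ • (p i - u)) x < inner ℝ (‖p l - u‖⁻¹ • (p l - u)) x} = ∅)) ∧ (∀ i j : Fin 12, i ≠ j → ¬ dist (p i) (p j) ≤ 1 + 1 / 4000 → Literature.Geometry.DiscreteGeometry.capCone (‖p i - u‖⁻¹ • (p i - u)) (893 / 1250) ∩ Literature.Geometry.DiscreteGeometry.capCone (‖p j - u‖⁻¹ • (p j - u)) (893 / 1250) = ∅)) → (∀ (u : EuclideanSpace ℝ (Fin 3)) (p : Fin 12 → EuclideanSpace ℝ (Fin 3)), (∀ i : Fin 12, 1 - 1 / 4000 ≤ dist u (p i) ∧ dist u (p i) ≤ 1 + 1 / 4000) → (∀ i j : Fin 12, i ≠ j → 1 - 1 / 4000 ≤ dist (p i) (p j) ∧ (dist (p i)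 (p j) ≤ 1 + 1 / 4000 ∨ 7 / 5 ≤ dist (p i) (p j))) → (∀ i j : Fin 12, i ≠ j → dist (p i) (p j) ≤ 1 + 1 / 4000 → Literature.Geometry.DiscreteGeometry.ballFraction (0 : EuclideanSpace ℝ (Fin 3)) (Literature.Geometry.DiscreteGeometry.capCone (‖p i - u‖⁻¹ • (p i - u)) (893 / 1250) ∩ {x : EuclideanSpace ℝ (Fin 3) | inner ℝ (‖p i - u‖⁻¹ • (p i - u)) x < inner ℝ (‖p j - u‖⁻¹ • (p j - u)) x}) ≤ 16423 / 1000000) ∧ (∀ i j k : Fin 12, i ≠ j → i ≠ k → j ≠ k → dist (p i) (p j) ≤ 1 + 1 / 4000 → dist (p i) (p k) ≤ 1 + 1 / 4000 → dist (p j) (p k) ≤ 1 + 1 / 4000 → (753 / 250000 : ℝ) ≤ Literature.Geometry.DiscreteGeometry.ballFraction (0 : EuclideanSpace ℝ (Fin 3)) (Literature.Geometry.DiscreteGeometry.capCone (‖p i - u‖⁻¹ • (p i - u)) (893 / 1250) ∩ {x : EuclideanSpace ℝ (Fin 3) | inner ℝ (‖p i - u‖⁻¹ • (p i - u)) x < inner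 ℝ (‖p j - u‖⁻¹ • (p j - u)) x} ∩ {x : EuclideanSpace ℝ (Fin 3) | inner ℝ (‖p i - u‖⁻¹ • (p i - u)) x < inner ℝ (‖p k - u‖⁻¹ • (p k - u)) x}))) → ∀ (u : EuclideanSpace ℝ (Fin 3)) (p : Fin 12 → EuclideanSpace ℝ (Fin 3)), (∀ i : Fin 12, 1 - 1 / 4000 ≤ dist u (p i) ∧ dist u (p i) ≤ 1 + 1 / 4000) → (∀ i j : Fin 12, i ≠ j → 1 - 1 / 4000 ≤ dist (p i) (p j) ∧ (dist (p i) (p j) ≤ 1 + 1 / 4000 ∨ 7 / 5 ≤ dist (p i) (p j))) → (∀ i : Fin 12, {j : Fin 12 | j ≠ i ∧ dist (p i) (p j) ≤ 1 + 1 / 4000}.ncard ≤ 4) → ∀ i : Fin 12, {j : Fin 12 | j ≠ i ∧ dist (p i) (p j) ≤ 1 + 1 / 4000}.ncard = 4 ∧ {q : Fin 12 × Fin 12 | q.1 < q.2 ∧ q.1 ≠ i ∧ q.2 ≠ i ∧ dist (p i) (p q.1) ≤ 1 + 1 / 4000 ∧ dist (p i) (p q.2) ≤ 1 + 1 / 4000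 ∧ dist (p q.1) (p q.2) ≤ 1 + 1 / 4000}.ncard = 2 := by
  exact Summit.AtomisticToContinuum.Crystallization.Theorems.ZeroDefectDensityBirth.stub_censusCore

/-- **K2 — the Voronoi census: every shell point is a (2,2)-vertex** — now a THEOREM of K2a–K2d (lead c5
split, 2026-08-17): every `p i` has exactly four soft contacts, exactly two pairs of which are in contact. -/
theorem stub_voronoiCensus : ∀ (u : EuclideanSpace ℝ (Fin 3)) (p : Fin 12 → EuclideanSpace ℝ (Fin 3)), (∀ i : Fin 12, 1 - 1 / 4000 ≤ dist u (p i) ∧ dist u (p i) ≤ 1 + 1 / 4000) → (∀ i j : Fin 12, i ≠ j → 1 - 1 / 4000 ≤ dist (p i) (p j) ∧ (dist (p i) (p j) ≤ 1 + 1 / 4000 ∨ 7 / 5 ≤ dist (p i) (p j))) → (∀ i : Fin 12, {j : Fin 12 | j ≠ i ∧ dist (p i) (p j) ≤ 1 + 1 / 4000}.ncard ≤ 4) → ∀ i : Fin 12, {j : Fin 12 | j ≠ i ∧ dist (p i) (p j) ≤ 1 + 1 / 4000}.ncard = 4 ∧ {q : Fin 12 × Fin 12 | q.1 < q.2 ∧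 q.1 ≠ i ∧ q.2 ≠ i ∧ dist (p i) (p q.1) ≤ 1 + 1 / 4000 ∧ dist (p i) (p q.2) ≤ 1 + 1 / 4000 ∧ dist (p q.1) (p q.2) ≤ 1 + 1 / 4000}.ncard = 2 :=
  fun u p hR hP h4 => stub_censusCore stub_censusFrame (stub_censusContain stub_censusCert) u p hR hP h4


/-- **STUB K3 — local structure: metric ⇒ rotation data** — CLOSED: proved in `Theorems/HullExactificationCascadeZeroDefectDensityLocalStructure.lean`
(+ …LocalStructureFrame p165959, …Points, …Planar, …Quad, …Vertex; lead c5 wave 1, worker K3) and imported by name.  Was (M/L):  Same soft shell, plus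
K2's conclusion.  There is a successor map `σ v` on the four contacts of each `v` (the azimuthal order
about the axis `u (p v)`, oriented by `det(p v - u, p a - u, p b - u) > 0`) which is a single 4-cycle,
has exactly two SMALL corners `(a, σ v a)` (the two in contact), closes small corners into triangles
coherently and LARGE corners into quadrilaterals: for a large corner, `w :=` the `σ a`-predecessor of `v`
is a contact of `a` at a large corner of `a`, lies within `62°` of `σ v a` as seen from `u`, hence is a
soft contact of it (dichotomy `≤ 1 + 1/4000 ∨ ≥ 7/5`), and the four rotations of the quad agree.
Windows: small corners `70.46°–70.60°`, large `107.77°–111.3°` (two small + two large = `360°`);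
`numerics/orient_check.py` confirms every identity on the exact fcc and hcp shells. -/
theorem stub_localStructure : ∀ (u : EuclideanSpace ℝ (Fin 3)) (p : Fin 12 → EuclideanSpace ℝ (Fin 3)), (∀ i : Fin 12, 1 - 1 / 4000 ≤ dist u (p i) ∧ dist u (p i) ≤ 1 + 1 / 4000) → (∀ i j : Fin 12, i ≠ j → 1 - 1 / 4000 ≤ dist (p i) (p j) ∧ (dist (p i) (p j) ≤ 1 + 1 / 4000 ∨ 7 / 5 ≤ dist (p i) (p j))) → (∀ i : Fin 12, {j : Fin 12 | j ≠ i ∧ dist (p i) (p j) ≤ 1 + 1 / 4000}.ncard = 4 ∧ {q : Fin 12 × Fin 12 | q.1 < q.2 ∧ q.1 ≠ i ∧ q.2 ≠ i ∧ dist (p i) (p q.1) ≤ 1 + 1 / 4000 ∧ dist (p i) (p q.2) ≤ 1 + 1 / 4000 ∧ dist (p q.1) (p q.2) ≤ 1 + 1 / 4000}.ncard = 2) → ∃ σ : Fin 12 → Fin 12 → Fin 12, (∀ v a : Fin 12, a ≠ v → dist (p v) (p a) ≤ 1 + 1 / 4000 → (σ v a ≠ v ∧ σ v a ≠ a ∧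 dist (p v) (p (σ v a)) ≤ 1 + 1 / 4000)) ∧ (∀ v a b : Fin 12, a ≠ v → b ≠ v → dist (p v) (p a) ≤ 1 + 1 / 4000 → dist (p v) (p b) ≤ 1 + 1 / 4000 → σ v a = σ v b → a = b) ∧ (∀ v a : Fin 12, a ≠ v → dist (p v) (p a) ≤ 1 + 1 / 4000 → (σ v (σ v a) ≠ a ∧ σ v (σ v (σ v (σ v a))) = a)) ∧ (∀ v : Fin 12, {a : Fin 12 | a ≠ v ∧ dist (p v) (p a) ≤ 1 + 1 / 4000 ∧ dist (p a) (p (σ v a)) ≤ 1 + 1 / 4000}.ncard = 2) ∧ (∀ v a : Fin 12, a ≠ v → dist (p v) (p a) ≤ 1 + 1 / 4000 → dist (p a) (p (σ v a)) ≤ 1 + 1 / 4000 → (σ a (σ v a) = v ∧ σ (σ v a) v = a)) ∧ (∀ v a : Fin 12, a ≠ v → dist (p v) (p a) ≤ 1 + 1 / 4000 → ¬ dist (p a) (p (σ v a)) ≤ 1 + 1 / 4000 → ∃ w : Fin 12, w ≠ a ∧ w ≠ σ v a ∧ dist (p a) (p w) ≤ 1 + 1 / 4000 ∧ σ a w = v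 ∧ dist (p w) (p (σ v a)) ≤ 1 + 1 / 4000 ∧ σ (σ v a) v = w ∧ σ w (σ v a) = a) := by
  exact Summit.AtomisticToContinuum.Crystallization.Theorems.ZeroDefectDensityBirth.stub_localStructure

/-- **STUB K4 — combinatorial classification** — CLOSED: proved in `Theorems/HullExactificationCascadeZeroDefectDensityCombClassification.lean`
(+ …CombRules p164185, …CombTables p164507, …CombCaseA/B/C/D; lead c5 wave 1, worker K4: straight-line growth of the map
from a root, no `native_decide`) and imported here by name.  Was (L; pure finite combinatorics):  An adjacency
`A` on `Fin 12` (irreflexive, symmetric, 4-regular) with a rotation `σ` (a 4-cycle on each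
neighbourhood) having exactly two small corners per vertex, small corners closing into triangles and
large corners into quadrilaterals, is the fcc (cuboctahedron) or hcp (anticuboctahedron) contact graph:
a bijection `Fin 12 ≃ fccKissingPattern` (resp. `hcpKissingPattern`) matching `A` with unit pattern
distances.  Face counts `3f₃ = 24 = 4f₄` give `χ = 2` for free; exhaustive search
(`numerics/enum_maps.py`, 11 898 nodes) finds exactly the two maps; components of size `< 12` are
impossible (`6 ∣ n`, and `n = 6` has odd `χ`).  Route: a verified growth search in the style of
`Literature.Geometry.DiscreteGeometry.KissingSearch*` (computational lane) composed with
`nonempty_tameContactGraph_one_iso_fcc` / `nonempty_tameContactGraph_zero_iso_hcp`, or a hand proof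
(all-(3,4,3,4) ⇒ medial graph of the cube; a (3,3,4,4) vertex ⇒ the orthobicupola belt). -/
theorem stub_combClassification : ∀ (A : Fin 12 → Fin 12 → Bool) (σ : Fin 12 → Fin 12 → Fin 12), (∀ i : Fin 12, A i i = false) → (∀ i j : Fin 12, A i j = A j i) → (∀ i : Fin 12, (Finset.univ.filter (fun j : Fin 12 => A i j = true)).card = 4) → (∀ v a : Fin 12, A v a = true → (A v (σ v a) = true ∧ σ v a ≠ a)) → (∀ v a b : Fin 12, A v a = true → A v b = true → σ v a = σ v b → a = b) → (∀ v a : Fin 12, A v a = true → (σ v (σ v a) ≠ a ∧ σ v (σ v (σ v (σ v a))) = a)) → (∀ v : Fin 12, (Finset.univ.filter (fun a : Fin 12 => A v a = true ∧ A a (σ v a) = true)).card = 2) → (∀ v a : Fin 12, A v a = true → A a (σ v a) = true → (σ a (σ v a) = v ∧ σ (σ v a) v = a)) → (∀ v a : Fin 12, A v a = true → A a (σ v a) = false → ∃ w : Fin 12, A a w = true ∧ σ a w = v ∧ A w (σ v a) = true ∧ σ (σ v a) v = w ∧ σ w (σ v a) = a) → (∃ e : Fin 12 ≃ {q : EuclideanSpace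 ℝ (Fin 3) // q ∈ Literature.Geometry.DiscreteGeometry.fccKissingPattern}, ∀ i j : Fin 12, i ≠ j → (A i j = true ↔ dist (e i).1 (e j).1 = 1)) ∨ (∃ e : Fin 12 ≃ {q : EuclideanSpace ℝ (Fin 3) // q ∈ Literature.Geometry.DiscreteGeometry.hcpKissingPattern}, ∀ i j : Fin 12, i ≠ j → (A i j = true ↔ dist (e i).1 (e j).1 = 1)) := by
  exact Summit.AtomisticToContinuum.Crystallization.Theorems.ZeroDefectDensityBirth.stub_combClassification

/-- **STUB 3 — scaling** — CLOSED: proved in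
`Theorems/HullExactificationCascadeZeroDefectDensityScaling.lean` (p151864, lead c4 wave 1) and imported
here by name.  (i) `SiteGood` is invariant under the dilation
`p ↦ a⁻¹ • p` (`d` scales, the strict shell maps bijectively, `d⁻¹ • (t - y)` is invariant);
(ii) soft kissing at scale `a` becomes soft kissing at scale `1`. -/
theorem stub_scaling : (∀ (S : Set (EuclideanSpace ℝ (Fin 3))) (u : EuclideanSpace ℝ (Fin 3)) (a : ℝ), 0 < a → Summit.AtomisticToContinuum.Crystallization.Theorems.SiteGood ((fun p : EuclideanSpace ℝ (Fin 3) => a⁻¹ • p) '' S) (a⁻¹ • u) → Summit.AtomisticToContinuum.Crystallization.Theorems.SiteGood S u) ∧ (∀ (S : Set (EuclideanSpace ℝ (Fin 3))) (v : EuclideanSpace ℝ (Fin 3)) (a : ℝ), 0 < a → ((∀ w ∈ S, w ≠ v → (1 - 1 / 4000) * a ≤ dist v w ∧ (dist v w ≤ (1 + 1 / 4000) * a ∨ 131 / 100 * a ≤ dist v w)) ∧ {w ∈ S | w ≠ v ∧ dist v w ≤ (1 + 1 / 4000) * a}.ncard = 12) → ((∀ w ∈ ((fun p : EuclideanSpace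 ℝ (Fin 3) => a⁻¹ • p) '' S), w ≠ (a⁻¹ • v) → 1 - 1 / 4000 ≤ dist (a⁻¹ • v) w ∧ (dist (a⁻¹ • v) w ≤ 1 + 1 / 4000 ∨ 131 / 100 ≤ dist (a⁻¹ • v) w)) ∧ {w ∈ ((fun p : EuclideanSpace ℝ (Fin 3) => a⁻¹ • p) '' S) | w ≠ (a⁻¹ • v) ∧ dist (a⁻¹ • v) w ≤ 1 + 1 / 4000}.ncard = 12)) := by
  exact Summit.AtomisticToContinuum.Crystallization.Theorems.ZeroDefectDensityBirth.stub_scaling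

/-- **STUB 4 — the link lemma** — CLOSED: proved in
`Theorems/HullExactificationCascadeZeroDefectDensityLinkLemma.lean` (+ `…LinkLemmaAux.lean`; p152705, p153341,
lead c4 wave 1) and imported here by name.  Apex `p` (the centre), vertex `c`, and
the four common soft contacts `n₁…n₄` of `p` and `c` (all nine mutual distances listed in `[1-η,1+η]`),
with the two link contacts and the four link non-contacts (`≥ 1.31`).  Seen from `c`, the `nᵢ` sit at
`≈ 60°` from the direction of `p`; consecutive azimuths differ by `70.53°` (contact) or `≥ 98.3°` (gap),
so both contact pairs are azimuthally consecutive and the two remaining gaps lie in `[98.3°, 120.7°]`.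
Type A (contacts `n₁n₂`, `n₃n₄`): the near-antipodal pairs (azimuth `180° ± 11.3°`, chord `≥ 1.72`)
are `{n₁n₃, n₂n₄}` or `{n₂n₃, n₄n₁}`.  Type B (contacts `n₁n₂`, `n₂n₃`): `n₁n₃` at azimuth `141.06°`
(chord `≈ 1.633 ≥ 1.6`) and `n₂n₄` near-antipodal (`≥ 1.7`). -/
theorem stub_linkLemma : (∀ (η : ℝ) (p c n₁ n₂ n₃ n₄ : EuclideanSpace ℝ (Fin 3)), 0 ≤ η → η ≤ 1 / 1000 → 1 - η ≤ dist c p → dist c p ≤ 1 + η → 1 - η ≤ dist p n₁ → dist p n₁ ≤ 1 + η → 1 - η ≤ dist p n₂ → dist p n₂ ≤ 1 + η → 1 - η ≤ dist p n₃ → dist p n₃ ≤ 1 + η → 1 - η ≤ dist p n₄ → dist p n₄ ≤ 1 + η → 1 - η ≤ dist c n₁ → dist c n₁ ≤ 1 + η → 1 - η ≤ dist c n₂ → dist c n₂ ≤ 1 + η → 1 - η ≤ dist c n₃ → dist c n₃ ≤ 1 + η → 1 - η ≤ dist c n₄ → dist c n₄ ≤ 1 + η → 1 - η ≤ dist n₁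 n₂ → dist n₁ n₂ ≤ 1 + η → 1 - η ≤ dist n₃ n₄ → dist n₃ n₄ ≤ 1 + η → 131 / 100 ≤ dist n₁ n₃ → 131 / 100 ≤ dist n₂ n₄ → 131 / 100 ≤ dist n₂ n₃ → 131 / 100 ≤ dist n₄ n₁ → (17 / 10 ≤ dist n₁ n₃ ∧ 17 / 10 ≤ dist n₂ n₄) ∨ (17 / 10 ≤ dist n₂ n₃ ∧ 17 / 10 ≤ dist n₄ n₁)) ∧ (∀ (η : ℝ) (p c n₁ n₂ n₃ n₄ : EuclideanSpace ℝ (Fin 3)), 0 ≤ η → η ≤ 1 / 1000 → 1 - η ≤ dist c p → dist c p ≤ 1 + η → 1 - η ≤ dist p n₁ → dist p n₁ ≤ 1 + η → 1 - η ≤ dist p n₂ → dist p n₂ ≤ 1 + η → 1 - η ≤ dist p n₃ → dist p n₃ ≤ 1 + η → 1 - η ≤ dist p n₄ → dist p n₄ ≤ 1 + η → 1 - η ≤ dist c n₁ → dist c n₁ ≤ 1 + η → 1 - η ≤ dist c n₂ → dist c n₂ ≤ 1 + η → 1 - η ≤ dist c n₃ → dist c n₃ ≤ 1 + η → 1 -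 η ≤ dist c n₄ → dist c n₄ ≤ 1 + η → 1 - η ≤ dist n₁ n₂ → dist n₁ n₂ ≤ 1 + η → 1 - η ≤ dist n₂ n₃ → dist n₂ n₃ ≤ 1 + η → 131 / 100 ≤ dist n₁ n₃ → 131 / 100 ≤ dist n₂ n₄ → 131 / 100 ≤ dist n₃ n₄ → 131 / 100 ≤ dist n₄ n₁ → 8 / 5 ≤ dist n₁ n₃ ∧ 17 / 10 ≤ dist n₂ n₄) := by
  exact Summit.AtomisticToContinuum.Crystallization.Theorems.ZeroDefectDensityBirth.stub_linkLemma

/-- **STUB 5 — the soft unit octahedron** — CLOSED: proved in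
`Theorems/HullExactificationCascadeZeroDefectDensityOctahedron.lean` (p152353, lead c4 wave 1; proved
constants `|d² - 2| ≤ 38η` for the equator diagonals, `≤ 29η` for the axis) and imported here by name.  Apexes `u, w`, equator
`z₁ z₂ z₃ z₄`; the twelve edges in `[1-η, 1+η]`, the three diagonals `≥ 1.31` (so the equator is not
folded): each diagonal is within `30η` of `√2`.  (Exact case: the equator lies on the circle where the
unit spheres about `u` and `w` meet; four unit chords closing up once force a square.  First-order
sensitivity of each diagonal to the twelve edges is `(1/(2√2)) Σ ±δe`, `L¹`-norm `3√2 ≈ 4.24`.) -/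
theorem stub_octahedron : (∀ (η : ℝ) (u w z₁ z₂ z₃ z₄ : EuclideanSpace ℝ (Fin 3)), 0 ≤ η → η ≤ 1 / 1000 → 1 - η ≤ dist u z₁ → dist u z₁ ≤ 1 + η → 1 - η ≤ dist u z₂ → dist u z₂ ≤ 1 + η → 1 - η ≤ dist u z₃ → dist u z₃ ≤ 1 + η → 1 - η ≤ dist u z₄ → dist u z₄ ≤ 1 + η → 1 - η ≤ dist w z₁ → dist w z₁ ≤ 1 + η → 1 - η ≤ dist w z₂ → dist w z₂ ≤ 1 + η → 1 - η ≤ dist w z₃ → dist w z₃ ≤ 1 + η → 1 - η ≤ dist w z₄ → dist w z₄ ≤ 1 + η → 1 - η ≤ dist z₁ z₂ → dist z₁ z₂ ≤ 1 + η → 1 - η ≤ dist z₂ z₃ → dist z₂ z₃ ≤ 1 + η → 1 - η ≤ dist z₃ z₄ → dist z₃ z₄ ≤ 1 + η → 1 - η ≤ dist z₄ z₁ → dist z₄ z₁ ≤ 1 + η → 131 / 100 ≤ dist z₁ z₃ → 131 / 100 ≤ dist z₂ z₄ → 131 / 100 ≤ dist u w → |dist z₁ z₃ - Real.sqrt 2|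 ≤ 30 * η ∧ |dist z₂ z₄ - Real.sqrt 2| ≤ 30 * η ∧ |dist u w - Real.sqrt 2| ≤ 30 * η) := by
  exact Summit.AtomisticToContinuum.Crystallization.Theorems.ZeroDefectDensityBirth.stub_octahedron

/-- **STUB 6 — cap atoms exist** — CLOSED: proved in `Theorems/HullExactificationCascadeZeroDefectDensityCapAtoms.lean`
(p154403; + …CapAtomsPattern p152971, …CapAtomsAux p153893; lead c4 wave 1) and imported by name.  Takes the link
lemma, both types, as hypotheses.  Under two-shell soft kissing, with soft contact graphs fcc/hcp at `u` and at
every soft neighbour of `u`: every induced soft 4-cycle `z₁z₂z₃z₄` of the shell of `u` has a common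
soft contact `w ≠ u`.  Route: in the shell of `z₁` the pair `(z₂, z₄)` is a square pair of the pattern
(its metric length is `≤ 1.513` by Euler's quadrilateral bound in the shell of `u`, while the
non-square non-contact pairs of a pattern link are `≥ 1.6` by the link lemma and the square pairs of
the pattern link are `≤ 1.513` by Euler again), so its fourth corner `x ∈ C(z₁)` is a soft contact of
`z₂, z₄`; likewise `x'` from `z₃`; the common soft contacts of `z₂, z₄` contain `u, z₁, z₃, x, x'`,
five `(1-η)`-separated points within `1+η` of both ends of a segment of length `∈ [1.31, 1.52]` unless
`x = x'` (at most four fit on that circle) — so `w := x = x'` caps the cycle. -/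
theorem stub_capAtoms : ∀ (S : Set (EuclideanSpace ℝ (Fin 3))) (u : EuclideanSpace ℝ (Fin 3)), u ∈ S → (∀ v ∈ S, dist u v ≤ 13 / 5 → ((∀ w ∈ S, w ≠ v → 1 - 1 / 4000 ≤ dist v w ∧ (dist v w ≤ 1 + 1 / 4000 ∨ 131 / 100 ≤ dist v w)) ∧ {w ∈ S | w ≠ v ∧ dist v w ≤ 1 + 1 / 4000}.ncard = 12)) → ((∃ e : {w : EuclideanSpace ℝ (Fin 3) // w ∈ S ∧ w ≠ u ∧ dist u w ≤ 1 + 1 / 400} ≃ {q : EuclideanSpace ℝ (Fin 3) // q ∈ Literature.Geometry.DiscreteGeometry.fccKissingPattern}, ∀ w w' : {w : EuclideanSpace ℝ (Fin 3) // w ∈ S ∧ w ≠ u ∧ dist u w ≤ 1 + 1 / 400}, w ≠ w' → (dist w.1 w'.1 ≤ 1 + 1 / 400 ↔ dist (e w).1 (e w').1 = 1)) ∨ (∃ e : {w : EuclideanSpace ℝ (Fin 3) // w ∈ S ∧ w ≠ u ∧ dist u w ≤ 1 + 1 / 400} ≃ {q : EuclideanSpace ℝ (Fin 3) // q ∈ Literature.Geometry.DiscreteGeometry.hcpKissingPattern},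 ∀ w w' : {w : EuclideanSpace ℝ (Fin 3) // w ∈ S ∧ w ≠ u ∧ dist u w ≤ 1 + 1 / 400}, w ≠ w' → (dist w.1 w'.1 ≤ 1 + 1 / 400 ↔ dist (e w).1 (e w').1 = 1))) → (∀ z ∈ S, z ≠ u → dist u z ≤ 1 + 1 / 4000 → ((∃ e : {w : EuclideanSpace ℝ (Fin 3) // w ∈ S ∧ w ≠ z ∧ dist z w ≤ 1 + 1 / 400} ≃ {q : EuclideanSpace ℝ (Fin 3) // q ∈ Literature.Geometry.DiscreteGeometry.fccKissingPattern}, ∀ w w' : {w : EuclideanSpace ℝ (Fin 3) // w ∈ S ∧ w ≠ z ∧ dist z w ≤ 1 + 1 / 400}, w ≠ w' → (dist w.1 w'.1 ≤ 1 + 1 / 400 ↔ dist (e w).1 (e w').1 = 1)) ∨ (∃ e : {w : EuclideanSpace ℝ (Fin 3) // w ∈ S ∧ w ≠ z ∧ dist z w ≤ 1 + 1 / 400} ≃ {q : EuclideanSpace ℝ (Fin 3) // q ∈ Literature.Geometry.DiscreteGeometry.hcpKissingPattern}, ∀ w w' : {w : EuclideanSpace ℝ (Fin 3) // w ∈ S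 ∧ w ≠ z ∧ dist z w ≤ 1 + 1 / 400}, w ≠ w' → (dist w.1 w'.1 ≤ 1 + 1 / 400 ↔ dist (e w).1 (e w').1 = 1)))) → (∀ (η : ℝ) (p c n₁ n₂ n₃ n₄ : EuclideanSpace ℝ (Fin 3)), 0 ≤ η → η ≤ 1 / 1000 → 1 - η ≤ dist c p → dist c p ≤ 1 + η → 1 - η ≤ dist p n₁ → dist p n₁ ≤ 1 + η → 1 - η ≤ dist p n₂ → dist p n₂ ≤ 1 + η → 1 - η ≤ dist p n₃ → dist p n₃ ≤ 1 + η → 1 - η ≤ dist p n₄ → dist p n₄ ≤ 1 + η → 1 - η ≤ dist c n₁ → dist c n₁ ≤ 1 + η → 1 - η ≤ dist c n₂ → dist c n₂ ≤ 1 + η → 1 - η ≤ dist c n₃ → dist c n₃ ≤ 1 + η → 1 - η ≤ dist c n₄ → dist c n₄ ≤ 1 + η → 1 - η ≤ dist n₁ n₂ → dist n₁ n₂ ≤ 1 + η → 1 - η ≤ dist n₃ n₄ → dist n₃ n₄ ≤ 1 + η → 131 / 100 ≤ dist n₁ n₃ → 131 / 100 ≤ dist n₂ n₄ → 131 / 100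 ≤ dist n₂ n₃ → 131 / 100 ≤ dist n₄ n₁ → (17 / 10 ≤ dist n₁ n₃ ∧ 17 / 10 ≤ dist n₂ n₄) ∨ (17 / 10 ≤ dist n₂ n₃ ∧ 17 / 10 ≤ dist n₄ n₁)) → (∀ (η : ℝ) (p c n₁ n₂ n₃ n₄ : EuclideanSpace ℝ (Fin 3)), 0 ≤ η → η ≤ 1 / 1000 → 1 - η ≤ dist c p → dist c p ≤ 1 + η → 1 - η ≤ dist p n₁ → dist p n₁ ≤ 1 + η → 1 - η ≤ dist p n₂ → dist p n₂ ≤ 1 + η → 1 - η ≤ dist p n₃ → dist p n₃ ≤ 1 + η → 1 - η ≤ dist p n₄ → dist p n₄ ≤ 1 + η → 1 - η ≤ dist c n₁ → dist c n₁ ≤ 1 + η → 1 - η ≤ dist c n₂ → dist c n₂ ≤ 1 + η → 1 - η ≤ dist c n₃ → dist c n₃ ≤ 1 + η → 1 - η ≤ dist c n₄ → dist c n₄ ≤ 1 + η → 1 - η ≤ dist n₁ n₂ → dist n₁ n₂ ≤ 1 + η → 1 - η ≤ dist n₂ n₃ → dist n₂ n₃ ≤ 1 + η → 131 / 100 ≤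 dist n₁ n₃ → 131 / 100 ≤ dist n₂ n₄ → 131 / 100 ≤ dist n₃ n₄ → 131 / 100 ≤ dist n₄ n₁ → 8 / 5 ≤ dist n₁ n₃ ∧ 17 / 10 ≤ dist n₂ n₄) → (∀ z₁ ∈ S, ∀ z₂ ∈ S, ∀ z₃ ∈ S, ∀ z₄ ∈ S, z₁ ≠ u → z₂ ≠ u → z₃ ≠ u → z₄ ≠ u → dist u z₁ ≤ 1 + 1 / 4000 → dist u z₂ ≤ 1 + 1 / 4000 → dist u z₃ ≤ 1 + 1 / 4000 → dist u z₄ ≤ 1 + 1 / 4000 → dist z₁ z₂ ≤ 1 + 1 / 4000 → dist z₂ z₃ ≤ 1 + 1 / 4000 → dist z₃ z₄ ≤ 1 + 1 / 4000 → dist z₄ z₁ ≤ 1 + 1 / 4000 → ¬ dist z₁ z₃ ≤ 1 + 1 / 4000 → ¬ dist z₂ z₄ ≤ 1 + 1 / 4000 → ∃ w ∈ S, w ≠ u ∧ dist w z₁ ≤ 1 + 1 / 4000 ∧ dist w z₂ ≤ 1 + 1 / 4000 ∧ dist w z₃ ≤ 1 + 1 / 4000 ∧ dist w z₄ ≤ 1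 + 1 / 4000) := by
  exact Summit.AtomisticToContinuum.Crystallization.Theorems.ZeroDefectDensityBirth.stub_capAtoms

/-- **STUB 7a — quantitative link lemma** — CLOSED: `Theorems/HullExactificationCascadeZeroDefectDensityLinkQ.lean`
(p154500; + …LinkQAux p154189; certified constants 19.75η and 35.6η, registered 40η/60η), imported by name.  With both square pairs of a vertex link pinned (`|d² - 2| ≤ 38η`), the near-antipodal pairs are
pinned to `|d² - 3| ≤ 40η` (the `+1/3 ∘ -1/3` rotation composition is stationary in the cosine errors) and the
type-B two-contact pair to `|d² - 8/3| ≤ 60η`. -/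
theorem stub_linkQ : (∀ (η : ℝ) (p c n₁ n₂ n₃ n₄ : EuclideanSpace ℝ (Fin 3)), 0 ≤ η → η ≤ 1 / 1000 → 1 - η ≤ dist c p → dist c p ≤ 1 + η → 1 - η ≤ dist p n₁ → dist p n₁ ≤ 1 + η → 1 - η ≤ dist p n₂ → dist p n₂ ≤ 1 + η → 1 - η ≤ dist p n₃ → dist p n₃ ≤ 1 + η → 1 - η ≤ dist p n₄ → dist p n₄ ≤ 1 + η → 1 - η ≤ dist c n₁ → dist c n₁ ≤ 1 + η → 1 - η ≤ dist c n₂ → dist c n₂ ≤ 1 + η → 1 - η ≤ dist c n₃ → dist c n₃ ≤ 1 + η → 1 - η ≤ dist c n₄ → dist c n₄ ≤ 1 + η → 1 - η ≤ dist n₁ n₂ → dist n₁ n₂ ≤ 1 + η → 1 - η ≤ dist n₃ n₄ → dist n₃ n₄ ≤ 1 + η → |dist n₂ n₃ ^ 2 - 2| ≤ 38 * η → |dist n₄ n₁ ^ 2 - 2| ≤ 38 * η → 131 / 100 ≤ dist n₁ n₃ → 131 / 100 ≤ dist n₂ n₄ → |dist n₁ n₃ ^ 2 - 3| ≤ 40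 * η ∧ |dist n₂ n₄ ^ 2 - 3| ≤ 40 * η) ∧ (∀ (η : ℝ) (p c n₁ n₂ n₃ n₄ : EuclideanSpace ℝ (Fin 3)), 0 ≤ η → η ≤ 1 / 1000 → 1 - η ≤ dist c p → dist c p ≤ 1 + η → 1 - η ≤ dist p n₁ → dist p n₁ ≤ 1 + η → 1 - η ≤ dist p n₂ → dist p n₂ ≤ 1 + η → 1 - η ≤ dist p n₃ → dist p n₃ ≤ 1 + η → 1 - η ≤ dist p n₄ → dist p n₄ ≤ 1 + η → 1 - η ≤ dist c n₁ → dist c n₁ ≤ 1 + η → 1 - η ≤ dist c n₂ → dist c n₂ ≤ 1 + η → 1 - η ≤ dist c n₃ → dist c n₃ ≤ 1 + η → 1 - η ≤ dist c n₄ → dist c n₄ ≤ 1 + η → 1 - η ≤ dist n₁ n₂ → dist n₁ n₂ ≤ 1 + η → 1 - η ≤ dist n₂ n₃ → dist n₂ n₃ ≤ 1 + η → |dist n₃ n₄ ^ 2 - 2| ≤ 38 * η → |dist n₄ n₁ ^ 2 - 2| ≤ 38 * η → 131 / 100 ≤ dist n₁ n₃ → 131 / 100 ≤ dist n₂ n₄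 → |dist n₁ n₃ ^ 2 - 8 / 3| ≤ 60 * η ∧ |dist n₂ n₄ ^ 2 - 3| ≤ 40 * η) := by
  exact Summit.AtomisticToContinuum.Crystallization.Theorems.ZeroDefectDensityBirth.stub_linkQ

/-- **SUB-GOAL — squared-form octahedron constants** — CLOSED (`|d² - 2| ≤ 38η` equator, `29η` axis):
`Theorems/HullExactificationCascadeZeroDefectDensityOctahedronSq.lean` (p153599), imported by name. -/
theorem oct_sq_bounds : ∀ (η : ℝ) (u w z₁ z₂ z₃ z₄ : EuclideanSpace ℝ (Fin 3)), 0 ≤ η → η ≤ 1 / 1000 → 1 - η ≤ dist u z₁ → dist u z₁ ≤ 1 + η → 1 - η ≤ dist u z₂ → dist u z₂ ≤ 1 + η → 1 - η ≤ dist u z₃ → dist u z₃ ≤ 1 + η → 1 - η ≤ dist u z₄ → dist u z₄ ≤ 1 + η → 1 - η ≤ dist w z₁ → dist w z₁ ≤ 1 + η → 1 - η ≤ dist w z₂ → dist w z₂ ≤ 1 + η → 1 - η ≤ dist w z₃ → dist w z₃ ≤ 1 + η → 1 - η ≤ dist w z₄ → dist w z₄ ≤ 1 + η → 1 - η ≤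 dist z₁ z₂ → dist z₁ z₂ ≤ 1 + η → 1 - η ≤ dist z₂ z₃ → dist z₂ z₃ ≤ 1 + η → 1 - η ≤ dist z₃ z₄ → dist z₃ z₄ ≤ 1 + η → 1 - η ≤ dist z₄ z₁ → dist z₄ z₁ ≤ 1 + η → 131 / 100 ≤ dist z₁ z₃ → 131 / 100 ≤ dist z₂ z₄ → 131 / 100 ≤ dist u w → |dist z₁ z₃ ^ 2 - 2| ≤ 38 * η ∧ |dist z₂ z₄ ^ 2 - 2| ≤ 38 * η ∧ |dist u w ^ 2 - 2| ≤ 29 * η := by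
  exact Summit.AtomisticToContinuum.Crystallization.Theorems.ZeroDefectDensityBirth.oct_sq_bounds

/-- **STUB 7b — pins** — CLOSED: `Theorems/HullExactificationCascadeZeroDefectDensityPins.lean` (p155647; +
…PinsPattern p155104; lead c4 wave 2), imported by name.  Combinatorial glue:  Under two-shell soft kissing, with the
soft contact graph of the shell of `u` isomorphic (via `e`) to the fcc or hcp pattern graph, caps on all induced
soft 4-cycles, the squared octahedron lemma and the quantitative link lemma: every pattern-`√2` pair of shell
points (a square diagonal — all twelve `√2` pairs of either pattern are square diagonals) satisfies
`|d² - 2| ≤ 38η`, every pattern-`√3` pair `|d² - 3| ≤ 40η`, every pattern-`√(8/3)` pair (hcp) `|d² - 8/3| ≤ 60η`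
(`η = 1/4000`).  Route: pattern facts by `decide` on the integer models (each `√2` pair spans an induced
4-cycle; each `√3` pair is the far pair of the link of its unique common neighbour, of type A or B; each
`√(8/3)` pair is the two-contact pair of a type-B link), pulled back along `e`; caps + `oct_sq_bounds` for the
squares, then `stub_linkQ` at the common neighbour. -/
theorem stub_pins : ∀ (S : Set (EuclideanSpace ℝ (Fin 3))) (u : EuclideanSpace ℝ (Fin 3)), u ∈ S → (∀ v ∈ S, dist u v ≤ 13 / 5 → ((∀ w ∈ S, w ≠ v → 1 - 1 / 4000 ≤ dist v w ∧ (dist v w ≤ 1 + 1 / 4000 ∨ 131 / 100 ≤ dist v w)) ∧ {w ∈ S | w ≠ v ∧ dist v w ≤ 1 + 1 / 4000}.ncard = 12)) → ∀ (P : Finset (EuclideanSpace ℝ (Fin 3))), (P = Literature.Geometry.DiscreteGeometry.fccKissingPattern ∨ P = Literature.Geometry.DiscreteGeometry.hcpKissingPattern) → ∀ (e : {w : EuclideanSpace ℝ (Fin 3) // w ∈ S ∧ w ≠ u ∧ dist u w ≤ 1 + 1 / 400} ≃ {q : EuclideanSpace ℝ (Fin 3) // q ∈ P}), (∀ w w'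 : {w : EuclideanSpace ℝ (Fin 3) // w ∈ S ∧ w ≠ u ∧ dist u w ≤ 1 + 1 / 400}, w ≠ w' → (dist w.1 w'.1 ≤ 1 + 1 / 400 ↔ dist (e w).1 (e w').1 = 1)) → (∀ z₁ ∈ S, ∀ z₂ ∈ S, ∀ z₃ ∈ S, ∀ z₄ ∈ S, z₁ ≠ u → z₂ ≠ u → z₃ ≠ u → z₄ ≠ u → dist u z₁ ≤ 1 + 1 / 4000 → dist u z₂ ≤ 1 + 1 / 4000 → dist u z₃ ≤ 1 + 1 / 4000 → dist u z₄ ≤ 1 + 1 / 4000 → dist z₁ z₂ ≤ 1 + 1 / 4000 → dist z₂ z₃ ≤ 1 + 1 / 4000 → dist z₃ z₄ ≤ 1 + 1 / 4000 → dist z₄ z₁ ≤ 1 + 1 / 4000 → ¬ dist z₁ z₃ ≤ 1 + 1 / 4000 → ¬ dist z₂ z₄ ≤ 1 + 1 / 4000 → ∃ w ∈ S, w ≠ u ∧ dist w z₁ ≤ 1 + 1 / 4000 ∧ dist w z₂ ≤ 1 + 1 / 4000 ∧ dist w z₃ ≤ 1 + 1 / 4000 ∧ dist w z₄ ≤ 1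 + 1 / 4000) → (∀ (η : ℝ) (u w z₁ z₂ z₃ z₄ : EuclideanSpace ℝ (Fin 3)), 0 ≤ η → η ≤ 1 / 1000 → 1 - η ≤ dist u z₁ → dist u z₁ ≤ 1 + η → 1 - η ≤ dist u z₂ → dist u z₂ ≤ 1 + η → 1 - η ≤ dist u z₃ → dist u z₃ ≤ 1 + η → 1 - η ≤ dist u z₄ → dist u z₄ ≤ 1 + η → 1 - η ≤ dist w z₁ → dist w z₁ ≤ 1 + η → 1 - η ≤ dist w z₂ → dist w z₂ ≤ 1 + η → 1 - η ≤ dist w z₃ → dist w z₃ ≤ 1 + η → 1 - η ≤ dist w z₄ → dist w z₄ ≤ 1 + η → 1 - η ≤ dist z₁ z₂ → dist z₁ z₂ ≤ 1 + η → 1 - η ≤ dist z₂ z₃ → dist z₂ z₃ ≤ 1 + η → 1 - η ≤ dist z₃ z₄ → dist z₃ z₄ ≤ 1 + η → 1 - η ≤ dist z₄ z₁ → dist z₄ z₁ ≤ 1 + η → 131 / 100 ≤ dist z₁ z₃ → 131 / 100 ≤ dist z₂ z₄ → 131 / 100 ≤ dist u w → |dist z₁ z₃ ^ 2 - 2| ≤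 38 * η ∧ |dist z₂ z₄ ^ 2 - 2| ≤ 38 * η ∧ |dist u w ^ 2 - 2| ≤ 29 * η) → (∀ (η : ℝ) (p c n₁ n₂ n₃ n₄ : EuclideanSpace ℝ (Fin 3)), 0 ≤ η → η ≤ 1 / 1000 → 1 - η ≤ dist c p → dist c p ≤ 1 + η → 1 - η ≤ dist p n₁ → dist p n₁ ≤ 1 + η → 1 - η ≤ dist p n₂ → dist p n₂ ≤ 1 + η → 1 - η ≤ dist p n₃ → dist p n₃ ≤ 1 + η → 1 - η ≤ dist p n₄ → dist p n₄ ≤ 1 + η → 1 - η ≤ dist c n₁ → dist c n₁ ≤ 1 + η → 1 - η ≤ dist c n₂ → dist c n₂ ≤ 1 + η → 1 - η ≤ dist c n₃ → dist c n₃ ≤ 1 + η → 1 - η ≤ dist c n₄ → dist c n₄ ≤ 1 + η → 1 - η ≤ dist n₁ n₂ → dist n₁ n₂ ≤ 1 + η → 1 - η ≤ dist n₃ n₄ → dist n₃ n₄ ≤ 1 + η → |dist n₂ n₃ ^ 2 - 2| ≤ 38 * η → |dist n₄ n₁ ^ 2 - 2| ≤ 38 * η → 131 / 100 ≤ dist n₁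 n₃ → 131 / 100 ≤ dist n₂ n₄ → |dist n₁ n₃ ^ 2 - 3| ≤ 40 * η ∧ |dist n₂ n₄ ^ 2 - 3| ≤ 40 * η) → (∀ (η : ℝ) (p c n₁ n₂ n₃ n₄ : EuclideanSpace ℝ (Fin 3)), 0 ≤ η → η ≤ 1 / 1000 → 1 - η ≤ dist c p → dist c p ≤ 1 + η → 1 - η ≤ dist p n₁ → dist p n₁ ≤ 1 + η → 1 - η ≤ dist p n₂ → dist p n₂ ≤ 1 + η → 1 - η ≤ dist p n₃ → dist p n₃ ≤ 1 + η → 1 - η ≤ dist p n₄ → dist p n₄ ≤ 1 + η → 1 - η ≤ dist c n₁ → dist c n₁ ≤ 1 + η → 1 - η ≤ dist c n₂ → dist c n₂ ≤ 1 + η → 1 - η ≤ dist c n₃ → dist c n₃ ≤ 1 + η → 1 - η ≤ dist c n₄ → dist c n₄ ≤ 1 + η → 1 - η ≤ dist n₁ n₂ → dist n₁ n₂ ≤ 1 + η → 1 - η ≤ dist n₂ n₃ → dist n₂ n₃ ≤ 1 + η → |dist n₃ n₄ ^ 2 - 2| ≤ 38 * η → |dist n₄ n₁ ^ 2 - 2|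 ≤ 38 * η → 131 / 100 ≤ dist n₁ n₃ → 131 / 100 ≤ dist n₂ n₄ → |dist n₁ n₃ ^ 2 - 8 / 3| ≤ 60 * η ∧ |dist n₂ n₄ ^ 2 - 3| ≤ 40 * η) → ((∀ t t' : {w : EuclideanSpace ℝ (Fin 3) // w ∈ S ∧ w ≠ u ∧ dist u w ≤ 1 + 1 / 400}, dist (e t).1 (e t').1 = Real.sqrt 2 → |dist t.1 t'.1 ^ 2 - 2| ≤ 38 / 4000) ∧ (∀ t t' : {w : EuclideanSpace ℝ (Fin 3) // w ∈ S ∧ w ≠ u ∧ dist u w ≤ 1 + 1 / 400}, dist (e t).1 (e t').1 = Real.sqrt 3 → |dist t.1 t'.1 ^ 2 - 3| ≤ 40 / 4000) ∧ (∀ t t' : {w : EuclideanSpace ℝ (Fin 3) // w ∈ S ∧ w ≠ u ∧ dist u w ≤ 1 + 1 / 400}, dist (e t).1 (e t').1 = Real.sqrt (8 / 3) → |dist t.1 t'.1 ^ 2 - 8 / 3| ≤ 60 / 4000)) := by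
  exact Summit.AtomisticToContinuum.Crystallization.Theorems.ZeroDefectDensityBirth.stub_pins

/-- **STUB 7c — coordinates, fcc** — CLOSED: `Theorems/HullExactificationCascadeZeroDefectDensityCoordsFcc.lean` (p157106;
+ …CoordsFccFrame p155632, …CoordsFccGood p156297, …CoordsFccBad p156775; lead c4 wave 2), imported by name.  Twelve points `τ q` labelled by the fcc
pattern, at distance `1 ± η` from `u`, with contacts `1 ± η`, square diagonals `√2` (`|d²-2| ≤ 38η`) and
`√3`-pairs (`|d²-3| ≤ 40η`) pinned, are carried by a linear isometry to within `49/1000` of the pattern: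
Gram–Schmidt the axis vectors `v₁ = p_a + p_b`, `v₂ = p_a - p_b`, `v₃ = p_c - p_c''` (`a,b = (1,±1,0)/√2`,
`c,c'' = (1,0,±1)/√2`, `p_q = τ q - u`; all their mutual pairs are contacts or diagonals), read the coordinates
of the eight "good" points from inner products with `p_a, p_b, p_c, p_c''` (types `0/1/√2/√3` only; error
≤ 0.02 each), and place the four antipodes of the axis points from two good references + norm + a sign
witness (error ≤ 0.04); budget file `numerics/plan6.py` of the lead's folder. -/
theorem stub_coordsFcc : ∀ (u : EuclideanSpace ℝ (Fin 3)) (τ : {q : EuclideanSpace ℝ (Fin 3) // q ∈ Literature.Geometry.DiscreteGeometry.fccKissingPattern} → EuclideanSpace ℝ (Fin 3)), (∀ q : {q : EuclideanSpace ℝ (Fin 3) // q ∈ Literature.Geometry.DiscreteGeometry.fccKissingPattern}, 1 - 1 / 4000 ≤ dist u (τ q) ∧ dist u (τ q) ≤ 1 + 1 / 4000) → (∀ q q' : {q : EuclideanSpace ℝ (Fin 3) // q ∈ Literature.Geometry.DiscreteGeometry.fccKissingPattern}, dist q.1 q'.1 = 1 → 1 - 1 / 4000 ≤ dist (τ q)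 (τ q') ∧ dist (τ q) (τ q') ≤ 1 + 1 / 4000) → (∀ q q' : {q : EuclideanSpace ℝ (Fin 3) // q ∈ Literature.Geometry.DiscreteGeometry.fccKissingPattern}, dist q.1 q'.1 = Real.sqrt 2 → |dist (τ q) (τ q') ^ 2 - 2| ≤ 38 / 4000) → (∀ q q' : {q : EuclideanSpace ℝ (Fin 3) // q ∈ Literature.Geometry.DiscreteGeometry.fccKissingPattern}, dist q.1 q'.1 = Real.sqrt 3 → |dist (τ q) (τ q') ^ 2 - 3| ≤ 40 / 4000) → ∃ A : EuclideanSpace ℝ (Fin 3) →ₗᵢ[ℝ] EuclideanSpace ℝ (Fin 3), ∀ q : {q : EuclideanSpace ℝ (Fin 3) // q ∈ Literature.Geometry.DiscreteGeometry.fccKissingPattern}, ‖(τ q - u) - A q.1‖ ≤ 49 / 1000 := by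
  exact Summit.AtomisticToContinuum.Crystallization.Theorems.ZeroDefectDensityBirth.stub_coordsFcc

/-- **STUB 7d — coordinates, hcp** — CLOSED: `Theorems/HullExactificationCascadeZeroDefectDensityCoordsHcp.lean` (p157928;
+ …CoordsHcpFrame p156108, …CoordsHcpGood p156805, …CoordsHcpBadCore p156810, …CoordsHcpBad p157346; lead c4 wave 2).  The same for the hcp pattern (same axis
quadruple, which lies in the anticuboctahedron too; five "bad" points: the two antipodes of the hexagonal axis
points and the lower triangle, whose `√(11/3)` partners are unpinned). -/
theorem stub_coordsHcp : ∀ (u : EuclideanSpace ℝ (Fin 3)) (τ : {q : EuclideanSpace ℝ (Fin 3) // q ∈ Literature.Geometry.DiscreteGeometry.hcpKissingPattern} → EuclideanSpace ℝ (Fin 3)), (∀ q : {q : EuclideanSpace ℝ (Fin 3) // q ∈ Literature.Geometry.DiscreteGeometry.hcpKissingPattern}, 1 - 1 / 4000 ≤ dist u (τ q) ∧ dist u (τ q) ≤ 1 + 1 / 4000) → (∀ q q' : {q : EuclideanSpace ℝ (Fin 3) // q ∈ Literature.Geometry.DiscreteGeometry.hcpKissingPattern}, dist q.1 q'.1 =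 1 → 1 - 1 / 4000 ≤ dist (τ q) (τ q') ∧ dist (τ q) (τ q') ≤ 1 + 1 / 4000) → (∀ q q' : {q : EuclideanSpace ℝ (Fin 3) // q ∈ Literature.Geometry.DiscreteGeometry.hcpKissingPattern}, dist q.1 q'.1 = Real.sqrt 2 → |dist (τ q) (τ q') ^ 2 - 2| ≤ 38 / 4000) → (∀ q q' : {q : EuclideanSpace ℝ (Fin 3) // q ∈ Literature.Geometry.DiscreteGeometry.hcpKissingPattern}, dist q.1 q'.1 = Real.sqrt 3 → |dist (τ q) (τ q') ^ 2 - 3| ≤ 40 / 4000) → (∀ q q' : {q : EuclideanSpace ℝ (Fin 3) // q ∈ Literature.Geometry.DiscreteGeometry.hcpKissingPattern}, dist q.1 q'.1 = Real.sqrt (8 / 3) → |dist (τ q) (τ q') ^ 2 - 8 / 3| ≤ 60 / 4000) → ∃ A : EuclideanSpace ℝ (Fin 3) →ₗᵢ[ℝ] EuclideanSpace ℝ (Fin 3), ∀ q : {q : EuclideanSpace ℝ (Fin 3) // q ∈ Literature.Geometry.DiscreteGeometry.hcpKissingPattern}, ‖(τ q - u) - A q.1‖ ≤ 49 / 1000 :=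 by
  exact Summit.AtomisticToContinuum.Crystallization.Theorems.ZeroDefectDensityBirth.stub_coordsHcp

/-! ## Assembly (kernel-checked from 7a–7d and the landed toolkits I/II) -/

/-- Norm band of a labelled shell point. [folklore] -/
theorem asm_norm_band {S : Set (EuclideanSpace ℝ (Fin 3))} {u : EuclideanSpace ℝ (Fin 3)} (hu : u ∈ S)
    (hS : (∀ v ∈ S, dist u v ≤ 13 / 5 → ((∀ w ∈ S, w ≠ v → 1 - 1 / 4000 ≤ dist v w ∧ (dist v w ≤ 1 + 1 / 4000 ∨ 131 / 100 ≤ dist v w)) ∧ {w ∈ S | w ≠ v ∧ dist v w ≤ 1 + 1 / 4000}.ncard = 12))) {P : Finset (EuclideanSpace ℝ (Fin 3))}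
    (e : {w : EuclideanSpace ℝ (Fin 3) // w ∈ S ∧ w ≠ u ∧ dist u w ≤ 1 + 1 / 400} ≃ {q : EuclideanSpace ℝ (Fin 3) // q ∈ P})
    (q : {q : EuclideanSpace ℝ (Fin 3) // q ∈ P}) :
    1 - 1 / 4000 ≤ dist u (e.symm q).1 ∧ dist u (e.symm q).1 ≤ 1 + 1 / 4000 := by
  have hw := (e.symm q).2
  have hsep := (Summit.AtomisticToContinuum.Crystallization.Theorems.ZeroDefectDensityBirth.softKissed_self hu hS).1 _ hw.1 hw.2.1
  refine ⟨hsep.1, ?_⟩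
  rcases hsep.2 with h | h
  · exact h
  · exfalso; linarith [hw.2.2]

/-- Contact band of two labelled shell points adjacent in the pattern. [folklore] -/
theorem asm_contact_band {S : Set (EuclideanSpace ℝ (Fin 3))} {u : EuclideanSpace ℝ (Fin 3)} (hu : u ∈ S)
    (hS : (∀ v ∈ S, dist u v ≤ 13 / 5 → ((∀ w ∈ S, w ≠ v → 1 - 1 / 4000 ≤ dist v w ∧ (dist v w ≤ 1 + 1 / 4000 ∨ 131 / 100 ≤ dist v w)) ∧ {w ∈ S | w ≠ v ∧ dist v w ≤ 1 + 1 / 4000}.ncard = 12))) {P : Finset (EuclideanSpace ℝ (Fin 3))}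
    (e : {w : EuclideanSpace ℝ (Fin 3) // w ∈ S ∧ w ≠ u ∧ dist u w ≤ 1 + 1 / 400} ≃ {q : EuclideanSpace ℝ (Fin 3) // q ∈ P})
    (he : ∀ w w' : {w : EuclideanSpace ℝ (Fin 3) // w ∈ S ∧ w ≠ u ∧ dist u w ≤ 1 + 1 / 400}, w ≠ w' → (dist w.1 w'.1 ≤ 1 + 1 / 400 ↔ dist (e w).1 (e w').1 = 1))
    (q q' : {q : EuclideanSpace ℝ (Fin 3) // q ∈ P}) (h1 : dist q.1 q'.1 = 1) :
    1 - 1 / 4000 ≤ dist (e.symm q).1 (e.symm q').1 ∧ dist (e.symm q).1 (e.symm q').1 ≤ 1 + 1 / 4000 := by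
  have _ := hu
  have hqq : q ≠ q' := by
    intro h; subst h; simp at h1
  have hne : e.symm q ≠ e.symm q' := fun h => hqq (e.symm.injective h)
  have hle : dist (e.symm q).1 (e.symm q').1 ≤ 1 + 1 / 400 := by
    rw [he _ _ hne]
    simpa using h1
  have hw := (e.symm q).2
  have hw' := (e.symm q').2
  have hSK := hS _ hw.1 (by linarith [hw.2.2])
  have hne1 : (e.symm q').1 ≠ (e.symm q).1 := fun h => hne (Subtype.ext h).symm
  have hsep := hSK.1 _ hw'.1 hne1
  refine ⟨hsep.1, ?_⟩
  rcases hsep.2 with h | h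
  · exact h
  · exfalso; linarith

/-- **Assembly** (the former STUB 7, now a theorem of 7a–7d): soft contact graph fcc/hcp at `u` + caps +
two-shell soft kissing ⇒ `SiteGood S u`. -/
theorem stub_assembly : ∀ (S : Set (EuclideanSpace ℝ (Fin 3))) (u : EuclideanSpace ℝ (Fin 3)), u ∈ S → (∀ v ∈ S, dist u v ≤ 13 / 5 → ((∀ w ∈ S, w ≠ v → 1 - 1 / 4000 ≤ dist v w ∧ (dist v w ≤ 1 + 1 / 4000 ∨ 131 / 100 ≤ dist v w)) ∧ {w ∈ S | w ≠ v ∧ dist v w ≤ 1 + 1 / 4000}.ncard = 12)) → ((∃ e : {w : EuclideanSpace ℝ (Fin 3) // w ∈ S ∧ w ≠ u ∧ dist u w ≤ 1 + 1 / 400} ≃ {q : EuclideanSpace ℝ (Fin 3) // q ∈ Literature.Geometry.DiscreteGeometry.fccKissingPattern}, ∀ w w' : {w : EuclideanSpace ℝ (Fin 3) // w ∈ S ∧ w ≠ u ∧ dist u w ≤ 1 + 1 / 400}, w ≠ w' → (dist w.1 w'.1 ≤ 1 + 1 / 400 ↔ dist (e w).1 (e w').1 = 1)) ∨ (∃ e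 : {w : EuclideanSpace ℝ (Fin 3) // w ∈ S ∧ w ≠ u ∧ dist u w ≤ 1 + 1 / 400} ≃ {q : EuclideanSpace ℝ (Fin 3) // q ∈ Literature.Geometry.DiscreteGeometry.hcpKissingPattern}, ∀ w w' : {w : EuclideanSpace ℝ (Fin 3) // w ∈ S ∧ w ≠ u ∧ dist u w ≤ 1 + 1 / 400}, w ≠ w' → (dist w.1 w'.1 ≤ 1 + 1 / 400 ↔ dist (e w).1 (e w').1 = 1))) → (∀ z₁ ∈ S, ∀ z₂ ∈ S, ∀ z₃ ∈ S, ∀ z₄ ∈ S, z₁ ≠ u → z₂ ≠ u → z₃ ≠ u → z₄ ≠ u → dist u z₁ ≤ 1 + 1 / 4000 → dist u z₂ ≤ 1 + 1 / 4000 → dist u z₃ ≤ 1 + 1 / 4000 → dist u z₄ ≤ 1 + 1 / 4000 → dist z₁ z₂ ≤ 1 + 1 / 4000 → dist z₂ z₃ ≤ 1 + 1 / 4000 → dist z₃ z₄ ≤ 1 + 1 / 4000 → dist z₄ z₁ ≤ 1 + 1 / 4000 → ¬ dist z₁ z₃ ≤ 1 + 1 / 4000 → ¬ dist z₂ z₄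 ≤ 1 + 1 / 4000 → ∃ w ∈ S, w ≠ u ∧ dist w z₁ ≤ 1 + 1 / 4000 ∧ dist w z₂ ≤ 1 + 1 / 4000 ∧ dist w z₃ ≤ 1 + 1 / 4000 ∧ dist w z₄ ≤ 1 + 1 / 4000) → (∀ (η : ℝ) (u w z₁ z₂ z₃ z₄ : EuclideanSpace ℝ (Fin 3)), 0 ≤ η → η ≤ 1 / 1000 → 1 - η ≤ dist u z₁ → dist u z₁ ≤ 1 + η → 1 - η ≤ dist u z₂ → dist u z₂ ≤ 1 + η → 1 - η ≤ dist u z₃ → dist u z₃ ≤ 1 + η → 1 - η ≤ dist u z₄ → dist u z₄ ≤ 1 + η → 1 - η ≤ dist w z₁ → dist w z₁ ≤ 1 + η → 1 - η ≤ dist w z₂ → dist w z₂ ≤ 1 + η → 1 - η ≤ dist w z₃ → dist w z₃ ≤ 1 + η → 1 - η ≤ dist w z₄ → dist w z₄ ≤ 1 + η → 1 - η ≤ dist z₁ z₂ → dist z₁ z₂ ≤ 1 + η → 1 - η ≤ dist z₂ z₃ → dist z₂ z₃ ≤ 1 + η → 1 - η ≤ dist z₃ z₄ → dist z₃ z₄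 ≤ 1 + η → 1 - η ≤ dist z₄ z₁ → dist z₄ z₁ ≤ 1 + η → 131 / 100 ≤ dist z₁ z₃ → 131 / 100 ≤ dist z₂ z₄ → 131 / 100 ≤ dist u w → |dist z₁ z₃ - Real.sqrt 2| ≤ 30 * η ∧ |dist z₂ z₄ - Real.sqrt 2| ≤ 30 * η ∧ |dist u w - Real.sqrt 2| ≤ 30 * η) → Summit.AtomisticToContinuum.Crystallization.Theorems.SiteGood S u := by
  intro S u hu hS hIso hCaps _hOct
  rcases hIso with ⟨e, he⟩ | ⟨e, he⟩
  · -- fcc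
    obtain ⟨hr2, hr3, -⟩ := stub_pins S u hu hS Literature.Geometry.DiscreteGeometry.fccKissingPattern
      (Or.inl rfl) e he hCaps oct_sq_bounds stub_linkQ.1 stub_linkQ.2
    obtain ⟨A, hA⟩ := stub_coordsFcc u (fun q => (e.symm q).1) (fun q => asm_norm_band hu hS e q)
      (fun q q' h => asm_contact_band hu hS e he q q' h)
      (fun q q' h => by simpa using hr2 (e.symm q) (e.symm q') (by simpa using h))
      (fun q q' h => by simpa using hr3 (e.symm q) (e.symm q') (by simpa using h))
    refine Summit.AtomisticToContinuum.Crystallization.Theorems.ZeroDefectDensityBirth.siteGood_of_frameApprox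
      hu hS (Or.inl rfl) e A fun t => ?_
    simpa using hA (e t)
  · -- hcp
    obtain ⟨hr2, hr3, hr83⟩ := stub_pins S u hu hS Literature.Geometry.DiscreteGeometry.hcpKissingPattern
      (Or.inr rfl) e he hCaps oct_sq_bounds stub_linkQ.1 stub_linkQ.2
    obtain ⟨A, hA⟩ := stub_coordsHcp u (fun q => (e.symm q).1) (fun q => asm_norm_band hu hS e q)
      (fun q q' h => asm_contact_band hu hS e he q q' h)
      (fun q q' h => by simpa using hr2 (e.symm q) (e.symm q') (by simpa using h))
      (fun q q' h => by simpa using hr3 (e.symm q) (e.symm q') (by simpa using h))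
      (fun q q' h => by simpa using hr83 (e.symm q) (e.symm q') (by simpa using h))
    refine Summit.AtomisticToContinuum.Crystallization.Theorems.ZeroDefectDensityBirth.siteGood_of_frameApprox
      hu hS (Or.inr rfl) e A fun t => ?_
    simpa using hA (e t)


/-! ## The kernel composition (kernel-checked): stubs K1–K4 ⇒ the one-shell kernel at `(1/4000, 7/5)` -/

/-- **Kernel composition (PROVED).**  `K1-sig → K2-sig → K3-sig → K4-sig →` (one-shell effective local
Hales at tolerance `1/4000`, gap `7/5`, conclusion phrased with the `1/400` thresholds): the twelve soft
neighbours of `u` are indexed by `Fin 12` (`ncard = 12`; the `1/400`- and `1/4000`-soft shells of `u`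
coincide under the gap), the radial window comes from the kissedness of `u`, the pairwise dichotomy from
the kissedness of each neighbour; K1–K3 produce the rotation data, K4 the pattern bijection, which is
transported back along the indexing equivalence. [folklore] -/
theorem kernel_of_stubs
    (hK1 : ∀ (u : EuclideanSpace ℝ (Fin 3)) (p : Fin 12 → EuclideanSpace ℝ (Fin 3)), (∀ i : Fin 12, 1 - 1 / 4000 ≤ dist u (p i) ∧ dist u (p i) ≤ 1 + 1 / 4000) → (∀ i j : Fin 12, i ≠ j → 1 - 1 / 4000 ≤ dist (p i) (p j) ∧ (dist (p i) (p j) ≤ 1 + 1 / 4000 ∨ 7 / 5 ≤ dist (p i) (p j))) → ∀ i : Fin 12, {j : Fin 12 | j ≠ i ∧ dist (p i) (p j) ≤ 1 + 1 / 4000}.ncard ≤ 4)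
    (hK2 : ∀ (u : EuclideanSpace ℝ (Fin 3)) (p : Fin 12 → EuclideanSpace ℝ (Fin 3)), (∀ i : Fin 12, 1 - 1 / 4000 ≤ dist u (p i) ∧ dist u (p i) ≤ 1 + 1 / 4000) → (∀ i j : Fin 12, i ≠ j → 1 - 1 / 4000 ≤ dist (p i) (p j) ∧ (dist (p i) (p j) ≤ 1 + 1 / 4000 ∨ 7 / 5 ≤ dist (p i) (p j))) → (∀ i : Fin 12, {j : Fin 12 | j ≠ i ∧ dist (p i) (p j) ≤ 1 + 1 / 4000}.ncard ≤ 4) → ∀ i : Fin 12, {j : Fin 12 | j ≠ i ∧ dist (p i) (p j) ≤ 1 + 1 / 4000}.ncard = 4 ∧ {q : Fin 12 × Fin 12 | q.1 < q.2 ∧ q.1 ≠ i ∧ q.2 ≠ i ∧ dist (p i) (p q.1) ≤ 1 + 1 / 4000 ∧ dist (p i) (p q.2) ≤ 1 + 1 / 4000 ∧ dist (p q.1) (p q.2) ≤ 1 + 1 / 4000}.ncard = 2)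
    (hK3 : ∀ (u : EuclideanSpace ℝ (Fin 3)) (p : Fin 12 → EuclideanSpace ℝ (Fin 3)), (∀ i : Fin 12, 1 - 1 / 4000 ≤ dist u (p i) ∧ dist u (p i) ≤ 1 + 1 / 4000) → (∀ i j : Fin 12, i ≠ j → 1 - 1 / 4000 ≤ dist (p i) (p j) ∧ (dist (p i) (p j) ≤ 1 + 1 / 4000 ∨ 7 / 5 ≤ dist (p i) (p j))) → (∀ i : Fin 12, {j : Fin 12 | j ≠ i ∧ dist (p i) (p j) ≤ 1 + 1 / 4000}.ncard = 4 ∧ {q : Fin 12 × Fin 12 | q.1 < q.2 ∧ q.1 ≠ i ∧ q.2 ≠ i ∧ dist (p i) (p q.1) ≤ 1 + 1 / 4000 ∧ dist (p i) (p q.2) ≤ 1 + 1 / 4000 ∧ dist (p q.1) (p q.2) ≤ 1 + 1 / 4000}.ncard = 2) → ∃ σ : Fin 12 → Fin 12 → Fin 12, (∀ v a : Fin 12, a ≠ v → dist (p v) (p a) ≤ 1 + 1 / 4000 → (σ v a ≠ v ∧ σ v a ≠ a ∧ dist (p v) (p (σ v a)) ≤ 1 + 1 / 4000)) ∧ (∀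 v a b : Fin 12, a ≠ v → b ≠ v → dist (p v) (p a) ≤ 1 + 1 / 4000 → dist (p v) (p b) ≤ 1 + 1 / 4000 → σ v a = σ v b → a = b) ∧ (∀ v a : Fin 12, a ≠ v → dist (p v) (p a) ≤ 1 + 1 / 4000 → (σ v (σ v a) ≠ a ∧ σ v (σ v (σ v (σ v a))) = a)) ∧ (∀ v : Fin 12, {a : Fin 12 | a ≠ v ∧ dist (p v) (p a) ≤ 1 + 1 / 4000 ∧ dist (p a) (p (σ v a)) ≤ 1 + 1 / 4000}.ncard = 2) ∧ (∀ v a : Fin 12, a ≠ v → dist (p v) (p a) ≤ 1 + 1 / 4000 → dist (p a) (p (σ v a)) ≤ 1 + 1 / 4000 → (σ a (σ v a) = v ∧ σ (σ v a) v = a)) ∧ (∀ v a : Fin 12, a ≠ v → dist (p v) (p a) ≤ 1 + 1 / 4000 → ¬ dist (p a) (p (σ v a)) ≤ 1 + 1 / 4000 → ∃ w : Fin 12, w ≠ a ∧ w ≠ σ v a ∧ dist (p a) (p w) ≤ 1 + 1 / 4000 ∧ σ a w = v ∧ dist (p w) (p (σ v a)) ≤ 1 + 1 / 4000 ∧ σ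 (σ v a) v = w ∧ σ w (σ v a) = a))
    (hK4 : ∀ (A : Fin 12 → Fin 12 → Bool) (σ : Fin 12 → Fin 12 → Fin 12), (∀ i : Fin 12, A i i = false) → (∀ i j : Fin 12, A i j = A j i) → (∀ i : Fin 12, (Finset.univ.filter (fun j : Fin 12 => A i j = true)).card = 4) → (∀ v a : Fin 12, A v a = true → (A v (σ v a) = true ∧ σ v a ≠ a)) → (∀ v a b : Fin 12, A v a = true → A v b = true → σ v a = σ v b → a = b) → (∀ v a : Fin 12, A v a = true → (σ v (σ v a) ≠ a ∧ σ v (σ v (σ v (σ v a))) = a)) → (∀ v : Fin 12, (Finset.univ.filter (fun a : Fin 12 => A v a = true ∧ A a (σ v a) = true)).card = 2) → (∀ v a : Fin 12, A v a = true → A a (σ v a) = true → (σ a (σ v a) = v ∧ σ (σ v a) v = a)) → (∀ v a : Fin 12, A v a = true → A a (σ v a) = false → ∃ w : Fin 12, A a w = true ∧ σ a w = v ∧ A w (σ v a) = true ∧ σ (σ v a) v = w ∧ σ w (σ v a) = a) → (∃ e : Fin 12 ≃ {q : EuclideanSpace ℝ (Fin 3) // q ∈ Literature.Geometry.DiscreteGeometry.fccKissingPattern},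 ∀ i j : Fin 12, i ≠ j → (A i j = true ↔ dist (e i).1 (e j).1 = 1)) ∨ (∃ e : Fin 12 ≃ {q : EuclideanSpace ℝ (Fin 3) // q ∈ Literature.Geometry.DiscreteGeometry.hcpKissingPattern}, ∀ i j : Fin 12, i ≠ j → (A i j = true ↔ dist (e i).1 (e j).1 = 1))) :
    ∀ (S : Set (EuclideanSpace ℝ (Fin 3))) (u : EuclideanSpace ℝ (Fin 3)), u ∈ S → (∀ v ∈ S, dist u v ≤ 1 + 1 / 4000 → ((∀ w ∈ S, w ≠ v → 1 - 1 / 4000 ≤ dist v w ∧ (dist v w ≤ 1 + 1 / 4000 ∨ 7 / 5 ≤ dist v w)) ∧ {w ∈ S | w ≠ v ∧ dist v w ≤ 1 + 1 / 4000}.ncard = 12)) → ((∃ e : {w : EuclideanSpace ℝ (Fin 3) // w ∈ S ∧ w ≠ u ∧ dist u w ≤ 1 + 1 / 400} ≃ {q : EuclideanSpace ℝ (Fin 3) // q ∈ Literature.Geometry.DiscreteGeometry.fccKissingPattern}, ∀ w w' : {w : EuclideanSpace ℝ (Fin 3) // w ∈ S ∧ w ≠ u ∧ dist u w ≤ 1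 + 1 / 400}, w ≠ w' → (dist w.1 w'.1 ≤ 1 + 1 / 400 ↔ dist (e w).1 (e w').1 = 1)) ∨ (∃ e : {w : EuclideanSpace ℝ (Fin 3) // w ∈ S ∧ w ≠ u ∧ dist u w ≤ 1 + 1 / 400} ≃ {q : EuclideanSpace ℝ (Fin 3) // q ∈ Literature.Geometry.DiscreteGeometry.hcpKissingPattern}, ∀ w w' : {w : EuclideanSpace ℝ (Fin 3) // w ∈ S ∧ w ≠ u ∧ dist u w ≤ 1 + 1 / 400}, w ≠ w' → (dist w.1 w'.1 ≤ 1 + 1 / 400 ↔ dist (e w).1 (e w').1 = 1))) := by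
  intro S u hu hH
  have hu' := hH u hu (by rw [dist_self]; norm_num)
  -- the `1/400`-soft shell of `u` is its `1/4000`-soft shell
  have hset : {w ∈ S | w ≠ u ∧ dist u w ≤ 1 + 1 / 400} = {w ∈ S | w ≠ u ∧ dist u w ≤ 1 + 1 / 4000} := by
    ext w
    simp only [Set.mem_setOf_eq]
    constructor
    · rintro ⟨hw, hwu, hd⟩
      refine ⟨hw, hwu, ?_⟩
      rcases (hu'.1 w hw hwu).2 with h | h
      · exact h
      · exfalso; linarith
    · rintro ⟨hw, hwu, hd⟩
      exact ⟨hw, hwu, by linarith⟩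
  have hcard : {w ∈ S | w ≠ u ∧ dist u w ≤ 1 + 1 / 400}.ncard = 12 := by rw [hset]; exact hu'.2
  have hN : Nat.card {w : EuclideanSpace ℝ (Fin 3) // w ∈ S ∧ w ≠ u ∧ dist u w ≤ 1 + 1 / 400} = 12 := hcard
  haveI : Finite {w : EuclideanSpace ℝ (Fin 3) // w ∈ S ∧ w ≠ u ∧ dist u w ≤ 1 + 1 / 400} :=
    Nat.finite_of_card_ne_zero (by rw [hN]; norm_num)
  obtain ⟨eN⟩ : Nonempty ({w : EuclideanSpace ℝ (Fin 3) // w ∈ S ∧ w ≠ u ∧ dist u w ≤ 1 + 1 / 400} ≃ Fin 12) :=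
    ⟨(Finite.equivFin _).trans (finCongr hN)⟩
  set p : Fin 12 → EuclideanSpace ℝ (Fin 3) := fun i => (eN.symm i).1 with hp
  have hmem : ∀ i, p i ∈ S ∧ p i ≠ u ∧ dist u (p i) ≤ 1 + 1 / 400 := fun i => (eN.symm i).2
  have hmem' : ∀ i, dist u (p i) ≤ 1 + 1 / 4000 := fun i => by
    rcases (hu'.1 (p i) (hmem i).1 (hmem i).2.1).2 with h | h
    · exact h
    · exfalso; linarith [(hmem i).2.2]
  have hR : ∀ i : Fin 12, 1 - 1 / 4000 ≤ dist u (p i) ∧ dist u (p i) ≤ 1 + 1 / 4000 := fun i =>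
    ⟨(hu'.1 (p i) (hmem i).1 (hmem i).2.1).1, hmem' i⟩
  have hinj : ∀ i j : Fin 12, i ≠ j → p i ≠ p j := by
    intro i j hij h
    exact hij (eN.symm.injective (Subtype.ext h))
  have hP : ∀ i j : Fin 12, i ≠ j → 1 - 1 / 4000 ≤ dist (p i) (p j) ∧
      (dist (p i) (p j) ≤ 1 + 1 / 4000 ∨ 7 / 5 ≤ dist (p i) (p j)) := by
    intro i j hij
    exact (hH (p i) (hmem i).1 (hmem' i)).1 (p j) (hmem j).1 (hinj j i (Ne.symm hij))
  have h4 := hK1 u p hR hP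
  have hcen := hK2 u p hR hP h4
  obtain ⟨σ, hσ1, hσ2, hσ3, hσC3, hσ4a, hσ4b⟩ := hK3 u p hR hP hcen
  -- the abstract data
  set A : Fin 12 → Fin 12 → Bool := fun i j => decide (j ≠ i ∧ dist (p i) (p j) ≤ 1 + 1 / 4000) with hA
  have hAiff : ∀ i j : Fin 12, A i j = true ↔ (j ≠ i ∧ dist (p i) (p j) ≤ 1 + 1 / 4000) := fun i j => by
    simp only [hA, decide_eq_true_eq]
  have hAff : ∀ i j : Fin 12, A i j = false ↔ ¬ (j ≠ i ∧ dist (p i) (p j) ≤ 1 + 1 / 4000) := fun i j => by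
    rw [← hAiff, Bool.not_eq_true]
  have x1 : ∀ i : Fin 12, A i i = false := fun i => by
    rw [hAff]; exact fun h => h.1 rfl
  have x2 : ∀ i j : Fin 12, A i j = A j i := fun i j => by
    rw [Bool.eq_iff_iff, hAiff, hAiff, dist_comm (p i) (p j)]
    exact ⟨fun h => ⟨Ne.symm h.1, h.2⟩, fun h => ⟨Ne.symm h.1, h.2⟩⟩
  have x3 : ∀ i : Fin 12, (Finset.univ.filter (fun j : Fin 12 => A i j = true)).card = 4 := by
    intro i
    have hs : ({j : Fin 12 | j ≠ i ∧ dist (p i) (p j) ≤ 1 + 1 / 4000} : Set (Fin 12)) =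
        ↑(Finset.univ.filter (fun j : Fin 12 => A i j = true)) := by
      ext j
      simp only [Set.mem_setOf_eq, Finset.coe_filter, Finset.mem_univ, true_and, hAiff]
    rw [← Set.ncard_coe_finset, ← hs]
    exact (hcen i).1
  have x4 : ∀ v a : Fin 12, A v a = true → (A v (σ v a) = true ∧ σ v a ≠ a) := by
    intro v a h
    rw [hAiff] at h
    obtain ⟨h1, h2, h3⟩ := hσ1 v a h.1 h.2
    exact ⟨(hAiff _ _).2 ⟨h1, h3⟩, h2⟩
  have x5 : ∀ v a b : Fin 12, A v a = true → A v b = true → σ v a = σ v b → a = b := by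
    intro v a b ha hb hab
    rw [hAiff] at ha hb
    exact hσ2 v a b ha.1 hb.1 ha.2 hb.2 hab
  have x6 : ∀ v a : Fin 12, A v a = true → (σ v (σ v a) ≠ a ∧ σ v (σ v (σ v (σ v a))) = a) := by
    intro v a h
    rw [hAiff] at h
    exact hσ3 v a h.1 h.2
  have x7 : ∀ v : Fin 12, (Finset.univ.filter (fun a : Fin 12 => A v a = true ∧ A a (σ v a) = true)).card = 2 := by
    intro v
    have hs : ({a : Fin 12 | a ≠ v ∧ dist (p v) (p a) ≤ 1 + 1 / 4000 ∧ dist (p a) (p (σ v a)) ≤ 1 + 1 / 4000} : Set (Fin 12)) =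
        ↑(Finset.univ.filter (fun a : Fin 12 => A v a = true ∧ A a (σ v a) = true)) := by
      ext a
      simp only [Set.mem_setOf_eq, Finset.coe_filter, Finset.mem_univ, true_and, hAiff]
      constructor
      · rintro ⟨h1, h2, h3⟩
        exact ⟨⟨h1, h2⟩, (hσ1 v a h1 h2).2.1, h3⟩
      · rintro ⟨⟨h1, h2⟩, -, h3⟩
        exact ⟨h1, h2, h3⟩
    rw [← Set.ncard_coe_finset, ← hs]
    exact hσC3 v
  have x8 : ∀ v a : Fin 12, A v a = true → A a (σ v a) = true → (σ a (σ v a) = v ∧ σ (σ v a) v = a) := by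
    intro v a h h'
    rw [hAiff] at h h'
    exact hσ4a v a h.1 h.2 h'.2
  have x9 : ∀ v a : Fin 12, A v a = true → A a (σ v a) = false → ∃ w : Fin 12, A a w = true ∧ σ a w = v ∧ A w (σ v a) = true ∧ σ (σ v a) v = w ∧ σ w (σ v a) = a := by
    intro v a h h'
    rw [hAiff] at h
    rw [hAff] at h'
    have hne : σ v a ≠ a := (hσ1 v a h.1 h.2).2.1
    have hnd : ¬ dist (p a) (p (σ v a)) ≤ 1 + 1 / 4000 := fun hd => h' ⟨hne, hd⟩
    obtain ⟨w, hwa, hwb, hdaw, hsaw, hdwb, hsbv, hswb⟩ := hσ4b v a h.1 h.2 hnd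
    exact ⟨w, (hAiff _ _).2 ⟨hwa, hdaw⟩, hsaw, (hAiff _ _).2 ⟨hwb.symm, hdwb⟩, hsbv, hswb⟩
  -- the value of `p` on an indexed neighbour, and the dichotomy on the shell type
  have hpe : ∀ w : {w : EuclideanSpace ℝ (Fin 3) // w ∈ S ∧ w ≠ u ∧ dist u w ≤ 1 + 1 / 400}, p (eN w) = w.1 := by
    intro w
    simp only [hp, Equiv.symm_apply_apply]
  have hdich : ∀ w w' : {w : EuclideanSpace ℝ (Fin 3) // w ∈ S ∧ w ≠ u ∧ dist u w ≤ 1 + 1 / 400}, w ≠ w' →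
      (dist w.1 w'.1 ≤ 1 + 1 / 400 ↔ (eN w' ≠ eN w ∧ dist (p (eN w)) (p (eN w')) ≤ 1 + 1 / 4000)) := by
    intro w w' hne
    have hij : eN w ≠ eN w' := fun h => hne (eN.injective h)
    rw [hpe w, hpe w']
    constructor
    · intro hd
      refine ⟨hij.symm, ?_⟩
      have := (hP (eN w) (eN w') hij).2
      rw [hpe w, hpe w'] at this
      rcases this with h | h
      · exact h
      · exfalso; linarith
    · rintro ⟨-, hd⟩
      linarith
  rcases hK4 A σ x1 x2 x3 x4 x5 x6 x7 x8 x9 with ⟨e, he⟩ | ⟨e, he⟩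
  · refine Or.inl ⟨eN.trans e, fun w w' hne => ?_⟩
    have hij : eN w ≠ eN w' := fun h => hne (eN.injective h)
    rw [hdich w w' hne, ← hAiff, he (eN w) (eN w') hij]
    simp only [Equiv.trans_apply]
  · refine Or.inr ⟨eN.trans e, fun w w' hne => ?_⟩
    have hij : eN w ≠ eN w' := fun h => hne (eN.injective h)
    rw [hdich w w' hne, ← hAiff, he (eN w) (eN w') hij]
    simp only [Equiv.trans_apply]

/-- **THE KERNEL** (one-shell effective local Hales at tolerance `1/4000`, gap `7/5`), from the four
registered stubs K1–K4 through `kernel_of_stubs`. -/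
theorem localHalesKernel75 : ∀ (S : Set (EuclideanSpace ℝ (Fin 3))) (u : EuclideanSpace ℝ (Fin 3)), u ∈ S → (∀ v ∈ S, dist u v ≤ 1 + 1 / 4000 → ((∀ w ∈ S, w ≠ v → 1 - 1 / 4000 ≤ dist v w ∧ (dist v w ≤ 1 + 1 / 4000 ∨ 7 / 5 ≤ dist v w)) ∧ {w ∈ S | w ≠ v ∧ dist v w ≤ 1 + 1 / 4000}.ncard = 12)) → ((∃ e : {w : EuclideanSpace ℝ (Fin 3) // w ∈ S ∧ w ≠ u ∧ dist u w ≤ 1 + 1 / 400} ≃ {q : EuclideanSpace ℝ (Fin 3) // q ∈ Literature.Geometry.DiscreteGeometry.fccKissingPattern}, ∀ w w' : {w : EuclideanSpace ℝ (Fin 3) // w ∈ S ∧ w ≠ u ∧ dist u w ≤ 1 + 1 / 400}, w ≠ w' → (dist w.1 w'.1 ≤ 1 + 1 / 400 ↔ dist (e w).1 (e w').1 = 1)) ∨ (∃ e : {w : EuclideanSpace ℝ (Fin 3) // w ∈ S ∧ w ≠ u ∧ dist u w ≤ 1 + 1 / 400} ≃ {q : EuclideanSpace ℝ (Fin 3)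 // q ∈ Literature.Geometry.DiscreteGeometry.hcpKissingPattern}, ∀ w w' : {w : EuclideanSpace ℝ (Fin 3) // w ∈ S ∧ w ≠ u ∧ dist u w ≤ 1 + 1 / 400}, w ≠ w' → (dist w.1 w'.1 ≤ 1 + 1 / 400 ↔ dist (e w).1 (e w').1 = 1))) :=
  kernel_of_stubs stub_softDegreeLeFour stub_voronoiCensus stub_localStructure stub_combClassification

/-! ## Two-shell bookkeeping (kernel-checked) -/

/-- Two-shell soft kissing with gap `7/5` weakens to c4's gap `131/100` (fed to the landed c4 lemmas). -/
theorem kissed_131_of_75 {S : Set (EuclideanSpace ℝ (Fin 3))} {u : EuclideanSpace ℝ (Fin 3)}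
    (hS : ∀ v ∈ S, dist u v ≤ 13 / 5 → ((∀ w ∈ S, w ≠ v → 1 - 1 / 4000 ≤ dist v w ∧ (dist v w ≤ 1 + 1 / 4000 ∨ 7 / 5 ≤ dist v w)) ∧ {w ∈ S | w ≠ v ∧ dist v w ≤ 1 + 1 / 4000}.ncard = 12)) :
    ∀ v ∈ S, dist u v ≤ 13 / 5 → ((∀ w ∈ S, w ≠ v → 1 - 1 / 4000 ≤ dist v w ∧ (dist v w ≤ 1 + 1 / 4000 ∨ 131 / 100 ≤ dist v w)) ∧ {w ∈ S | w ≠ v ∧ dist v w ≤ 1 + 1 / 4000}.ncard = 12) := by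
  intro v hv hd
  obtain ⟨hsep, hcard⟩ := hS v hv hd
  refine ⟨fun w hw hwv => ?_, hcard⟩
  obtain ⟨h1, h2⟩ := hsep w hw hwv
  refine ⟨h1, ?_⟩
  rcases h2 with h | h
  · exact Or.inl h
  · exact Or.inr (by linarith)

/-- Under two-shell `1/4000`-soft kissing with gap `7/5` about `u`, the ONE-shell hypotheses of the kernel
hold at `u` and at every soft neighbour `z` of `u` (`dist u v ≤ dist u z + dist z v ≤ 2.0005 ≤ 13/5`). -/
theorem oneShell_of_twoShell (S : Set (EuclideanSpace ℝ (Fin 3))) (u : EuclideanSpace ℝ (Fin 3))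
    (hS : ∀ v ∈ S, dist u v ≤ 13 / 5 → ((∀ w ∈ S, w ≠ v → 1 - 1 / 4000 ≤ dist v w ∧ (dist v w ≤ 1 + 1 / 4000 ∨ 7 / 5 ≤ dist v w)) ∧ {w ∈ S | w ≠ v ∧ dist v w ≤ 1 + 1 / 4000}.ncard = 12))
    (z : EuclideanSpace ℝ (Fin 3)) (hz : z = u ∨ (z ∈ S ∧ dist u z ≤ 1 + 1 / 4000)) :
    ∀ v ∈ S, dist z v ≤ 1 + 1 / 4000 → ((∀ w ∈ S, w ≠ v → 1 - 1 / 4000 ≤ dist v w ∧ (dist v w ≤ 1 + 1 / 4000 ∨ 7 / 5 ≤ dist v w)) ∧ {w ∈ S | w ≠ v ∧ dist v w ≤ 1 + 1 / 4000}.ncard = 12) := by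
  intro v hv hzv
  have hzu : dist u z ≤ 1 + 1 / 4000 := by
    rcases hz with rfl | ⟨-, h⟩
    · rw [dist_self]; norm_num
    · exact h
  have huv : dist u v ≤ 13 / 5 := by
    have := dist_triangle u z v
    linarith
  exact hS v hv huv

/-- POINTWISE, SCALE `1`: two-shell `1/4000`-soft kissing with gap `7/5` about `u ∈ S` forces `SiteGood S u`
(the kernel at `u` and at its twelve neighbours, then c4's cap atoms and assembly at gap `131/100`). -/
theorem siteGood_of_twoShellSoftKissed (S : Set (EuclideanSpace ℝ (Fin 3)))
    (u : EuclideanSpace ℝ (Fin 3)) (hu : u ∈ S) (hS : ∀ v ∈ S, dist u v ≤ 13 / 5 → ((∀ w ∈ S, w ≠ v → 1 - 1 / 4000 ≤ dist v w ∧ (dist v w ≤ 1 + 1 / 4000 ∨ 7 / 5 ≤ dist v w)) ∧ {w ∈ S | w ≠ v ∧ dist v w ≤ 1 + 1 / 4000}.ncard = 12)) :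
    Summit.AtomisticToContinuum.Crystallization.Theorems.SiteGood S u := by
  have hIso_u := localHalesKernel75 S u hu (oneShell_of_twoShell S u hS u (Or.inl rfl))
  have hIso_z : ∀ z ∈ S, z ≠ u → dist u z ≤ 1 + 1 / 4000 → ((∃ e : {w : EuclideanSpace ℝ (Fin 3) // w ∈ S ∧ w ≠ z ∧ dist z w ≤ 1 + 1 / 400} ≃ {q : EuclideanSpace ℝ (Fin 3) // q ∈ Literature.Geometry.DiscreteGeometry.fccKissingPattern}, ∀ w w' : {w : EuclideanSpace ℝ (Fin 3) // w ∈ S ∧ w ≠ z ∧ dist z w ≤ 1 + 1 / 400}, w ≠ w' → (dist w.1 w'.1 ≤ 1 + 1 / 400 ↔ dist (e w).1 (e w').1 = 1)) ∨ (∃ e : {w : EuclideanSpace ℝ (Fin 3) // w ∈ S ∧ w ≠ z ∧ dist z w ≤ 1 + 1 / 400} ≃ {q : EuclideanSpace ℝ (Fin 3) // q ∈ Literature.Geometry.DiscreteGeometry.hcpKissingPattern}, ∀ w w' : {w : EuclideanSpace ℝ (Fin 3) // w ∈ S ∧ w ≠ z ∧ dist z w ≤ 1 + 1 / 400}, w ≠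 w' → (dist w.1 w'.1 ≤ 1 + 1 / 400 ↔ dist (e w).1 (e w').1 = 1))) :=
    fun z hz _ hdz => localHalesKernel75 S z hz (oneShell_of_twoShell S u hS z (Or.inr ⟨hz, hdz⟩))
  have hS' := kissed_131_of_75 hS
  have hcaps := stub_capAtoms S u hu hS' hIso_u hIso_z stub_linkLemma.1 stub_linkLemma.2
  exact stub_assembly S u hu hS' hIso_u hcaps stub_octahedron

/-- **Soft kissing dilates (gap `7/5`).** If `v` is softly twelve-kissed in `S` at scale `a` with gap `7/5`,
then the same holds at scale `1` about `a⁻¹ • v` in `(a⁻¹ • ·) '' S` (c4's `softKissing_dilate` at the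
raised gap; same proof). [folklore] -/
theorem softKissing_dilate75 {S : Set (EuclideanSpace ℝ (Fin 3))} {v : EuclideanSpace ℝ (Fin 3)} {a : ℝ}
    (ha : 0 < a)
    (h : (∀ w ∈ S, w ≠ v → (1 - 1 / 4000) * a ≤ dist v w ∧
        (dist v w ≤ (1 + 1 / 4000) * a ∨ 7 / 5 * a ≤ dist v w)) ∧
      {w ∈ S | w ≠ v ∧ dist v w ≤ (1 + 1 / 4000) * a}.ncard = 12) :
    (∀ w ∈ ((fun p : EuclideanSpace ℝ (Fin 3) => a⁻¹ • p) '' S), w ≠ (a⁻¹ • v) →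
        1 - 1 / 4000 ≤ dist (a⁻¹ • v) w ∧
          (dist (a⁻¹ • v) w ≤ 1 + 1 / 4000 ∨ 7 / 5 ≤ dist (a⁻¹ • v) w)) ∧
      {w ∈ ((fun p : EuclideanSpace ℝ (Fin 3) => a⁻¹ • p) '' S) | w ≠ (a⁻¹ • v) ∧
        dist (a⁻¹ • v) w ≤ 1 + 1 / 4000}.ncard = 12 := by
  obtain ⟨hrad, hcount⟩ := h
  have hinj := Summit.AtomisticToContinuum.Crystallization.Theorems.ZeroDefectDensityBirth.dilate_injective ha
  constructor
  · intro w' hw' hne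
    obtain ⟨w, hw, rfl⟩ := hw'
    have hwv : w ≠ v := fun h => hne (by rw [h])
    obtain ⟨h1, h2⟩ := hrad w hw hwv
    show 1 - 1 / 4000 ≤ dist (a⁻¹ • v) (a⁻¹ • w) ∧
      (dist (a⁻¹ • v) (a⁻¹ • w) ≤ 1 + 1 / 4000 ∨ 7 / 5 ≤ dist (a⁻¹ • v) (a⁻¹ • w))
    rw [dist_smul₀, norm_inv, Real.norm_of_nonneg ha.le, inv_mul_eq_div]
    exact ⟨(le_div_iff₀ ha).2 h1,
      h2.imp (fun h => (div_le_iff₀ ha).2 h) (fun h => (le_div_iff₀ ha).2 h)⟩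
  · have hset : {w ∈ ((fun p : EuclideanSpace ℝ (Fin 3) => a⁻¹ • p) '' S) | w ≠ (a⁻¹ • v) ∧
        dist (a⁻¹ • v) w ≤ 1 + 1 / 4000} = (fun p : EuclideanSpace ℝ (Fin 3) => a⁻¹ • p) ''
          {w ∈ S | w ≠ v ∧ dist v w ≤ (1 + 1 / 4000) * a} := by
      ext w'
      simp only [Set.mem_setOf_eq, Set.mem_image]
      constructor
      · rintro ⟨⟨w, hw, rfl⟩, hne, hle⟩
        refine ⟨w, ⟨hw, fun h => hne (by rw [h]), ?_⟩, rfl⟩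
        rwa [dist_smul₀, norm_inv, Real.norm_of_nonneg ha.le, inv_mul_eq_div, div_le_iff₀ ha] at hle
      · rintro ⟨w, ⟨hw, hne, hle⟩, rfl⟩
        refine ⟨⟨w, hw, rfl⟩, fun h => hne (hinj h), ?_⟩
        rwa [dist_smul₀, norm_inv, Real.norm_of_nonneg ha.le, inv_mul_eq_div, div_le_iff₀ ha]
    rw [hset, Set.ncard_image_of_injective _ hinj, hcount]

/-- POINTWISE, ANY SCALE: a `1/4000`-soft-kissed `13/5·a`-neighbourhood with gap `7/5·a` forces a good
shell. -/
theorem siteGood_of_softKissedNbhd (S : Set (EuclideanSpace ℝ (Fin 3)))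
    (u : EuclideanSpace ℝ (Fin 3)) (hu : u ∈ S)
    (h : ∃ a : ℝ, 0 < a ∧ ∀ v ∈ S, dist u v ≤ 13 / 5 * a → ((∀ w ∈ S, w ≠ v → (1 - 1 / 4000) * a ≤ dist v w ∧ (dist v w ≤ (1 + 1 / 4000) * a ∨ 7 / 5 * a ≤ dist v w)) ∧ {w ∈ S | w ≠ v ∧ dist v w ≤ (1 + 1 / 4000) * a}.ncard = 12)) :
    Summit.AtomisticToContinuum.Crystallization.Theorems.SiteGood S u := by
  obtain ⟨a, ha, hSK⟩ := h
  refine stub_scaling.1 S u a ha ?_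
  refine siteGood_of_twoShellSoftKissed _ _ ⟨u, hu, rfl⟩ ?_
  rintro v' ⟨v, hv, rfl⟩ hd
  have hainv : 0 < a⁻¹ := inv_pos.mpr ha
  have hd' : dist u v ≤ 13 / 5 * a := by
    have h1 : dist (a⁻¹ • u) (a⁻¹ • v) = a⁻¹ * dist u v := by
      rw [dist_smul₀, Real.norm_of_nonneg hainv.le]
    rw [h1] at hd
    have := (inv_mul_le_iff₀ ha).mp hd
    linarith
  exact softKissing_dilate75 ha (hSK v hv hd')

/-! ## Composition (kernel-checked): the stubs imply the crux BY NAME -/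

/-- THE SKELETON THEOREM (registered form, as `#h21_check_skeleton` requires: concludes the route decl
`ZeroDefectDensity` BY NAME, no hypotheses, `sorry` only through the five declared `stub_*`): the defect
set is contained in the set of particles without a soft-kissed neighbourhood (`siteGood_of_softKissedNbhd`),
whose density tends to `0` (`stub_softKissingOrder`). -/
theorem ZeroDefectDensity_of : Summit.AtomisticToContinuum.Crystallization.Theses.HullExactificationCascade.ZeroDefectDensity := by
  intro x hx
  refine Summit.AtomisticToContinuum.Crystallization.Theorems.ZeroDefectDensityBirth.tendsto_density_mono
    (P := fun N i => ¬ Summit.AtomisticToContinuum.Crystallization.Theorems.SiteGood (Set.range (x N)) (x N i))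
    ?_ (stub_softKissingOrder x hx)
  intro N i hi hgood
  exact hi (siteGood_of_softKissedNbhd (Set.range (x N)) (x N i) ⟨i, rfl⟩ hgood)

end Summit.AtomisticToContinuum.Crystallization.Cruxes.ZeroDefectDensity.Birth
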